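import Literature.MathematicalPhysics.PowerSystems.QuadraticDroopVoltageStabilization
import Literature.LinearAlgebra.Matrix.DiagonalSymmetricProduct
import Literature.Analysis.ODE.LyapunovIndirectMethod
import Literature.Analysis.ODE.ExtendedInvariancePrinciple
import HarnessLib

/-!
# Quadratic droop control: stability from the reduced Jacobian (Simpson-Porco–Dörfler–Bullo 2017,
# Theorem 3.2) — the linearised closed loop, its symmetrisation `M`, the Schur complement
# `[E_L]⁻¹J_red`, and the reduced (differential-algebraic) state matrix

Topic `Literature/MathematicalPhysics/PowerSystems` (LADDER-GRIDFUSION rung G3.b «droop microgrid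
with Q–V dynamics»; seat gridfusion-lit-2, g12).  Companion of `QuadraticDroopVoltageStabilization.lean`
(the model `QuadDroopNetwork`, the closed loop (3.3), Theorem 3.1, Theorem 3.3, Proposition 7.2),
which left THEOREM 3.2 untyped.  Source: [SimpsonporcoDorflerBullo2017] = arXiv:1507.00431, §3.2
Theorem 3.2 and its proof (held text p0010 L17–L60, read on the page this session).

THE PRINTED THEOREM (p0010 L17–L28). «Consider the closed-loop system (3.3) resulting from the quadratic
droop controller (3.1). If the Jacobian of the reduced power flow equation (3.7),
`J_red(E_L) = ∂Q_L/∂E_L(E_L) + [E_L]B_red + [B_red(E_L − E_L*)]` (3.9), is a Hurwitz matrix when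
evaluated at a solution `E_L ∈ ℝ^n_{>0}` of (3.7), then the equilibrium point `(E_L, E_I)` of the
differential-algebraic system (3.3) is locally exponentially stable. Moreover, assuming that
`∂Q_i(E_i)/∂E_i ≤ 0` for each load bus, a sufficient condition for (3.9) to be Hurwitz is that
`B_red ≺ [E_L]⁻²[Q_L(E_L)]` (3.10).»

THE PRINTED PROOF (p0010 L30–L60), which this file follows step by step.  «We appeal to [RR:04]
(Riaza 2004), which states that local stability of the differential-algebraic system (3.3) at the
equilibrium `E ∈ ℝ^{n+m}_{>0}` may be studied by linearizing the differential algebraic system,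
eliminating the algebraic equations from the system matrix, and checking that the resulting reduced
matrix is Hurwitz.»  (1) The Jacobian of (3.3) is `J = [E]B + [BE] + D` (3.11′), `D` diagonal with
`D_ll = dQ_l/dE_l`, `D_ii = K_i(E_i − E_i*) + K_iE_i` — §1 `jac`, PROVED to be the Fréchet derivative
of `closedLoop` (`hasFDerivAt_closedLoop`).  (2) «Since `E` is strictly positive, we left-multiply through
by `[E]⁻¹`»: `M = Mᵀ = B + [E]⁻¹([BE] + D)`, `J = [E]M` — §1 `symJac`, `jac_eq_diagonal_mul_symJac`.
(3) «one may use (3.4), (3.6), (3.8) and (3.11) to simplify `M` to `[M₁₁ B_LI; B_IL B_II + K_I]`,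
`M₁₁ = [E_L]⁻¹∂Q_L/∂E_L + B_LL + [E_L]⁻¹[B_red(E_L − E_L*)]`» — §2 `symJac_liftState`.  (4) «the
Schur complement [of `−M` w.r.t. `−(B_II + K_I)`] is … exactly `−[E_L]⁻¹` times the Jacobian (3.9)» —
§2 `symJacRed`, `jacRed_eq_diagonal_mul_symJacRed`, `schur_symJac`.  (5) «Since `J_red` is Hurwitz …
the Schur complement is positive definite, and hence `M_red` is [negative] definite»: §3
`posDef_neg_symJacRed_of_isHurwitz` (the print argues through `M`-matrix `D`-stability; here the
shorter road of the tree's `DiagonalSymmetricProduct.lean`: `[E_L]S` Hurwitz with `S` symmetric forces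
`−S ≻ 0` — Horn–Johnson Thm. 7.6.1 (a); no sign condition on the off-diagonal of `J_red` is needed),
`posDef_neg_symJac` (`−M ≻ 0` by the Schur-complement criterion), `posDef_neg_Mred` («eliminating the top
set of algebraic equations, we arrive at a reduced GEP `M_red v_I = λ[E_I]⁻¹τ_I v_I` where
`M_red = M_II − M_IL M_LL⁻¹ M_LI`»; `−M_red ≻ 0` as a Schur complement of `−M ≻ 0`).  (6) «The matrices on
both sides are symmetric, and … `[E_I]⁻¹τ_I` … is diagonal and positive definite. The eigenvalues …
are therefore real, and `λ_i < 0` … iff `M_red` is negative definite» — §3 `redStateMatrix` (the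
print's «resulting reduced matrix» `τ_I⁻¹(J_II − J_IL J_LL⁻¹ J_LI)` of the linearised DAE),
`redStateMatrix_liftState` (`= [E_I/τ_I]M_red`), **`redStateMatrix_isHurwitz`** and
`redStateMatrix_eig_real`; `isUnit_jacLL_det` records that the algebraic equations CAN be eliminated
(`J_LL = [E_L]M_LL` invertible: the DAE has index one at the equilibrium).  (7) The «moreover»: §4
**`jacRed_isHurwitz_of_Bred_lt`** — at a solution of (3.7), `[E_L]⁻¹J_red = [E_L]⁻¹∂Q_L/∂E_L + B_red −
[E_L]⁻²[Q_L(E_L)]`, negative definite under `∂Q_l/∂E_l ≤ 0` and (3.10), hence `J_red = [E_L]([E_L]⁻¹J_red)`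
Hurwitz.  §5 assembles **`theorem_3_2_reducedStateMatrix`** and the ZI-load instance
**`theorem_3_3_redStateMatrix_isHurwitz`** (Theorem 3.3's «locally exponentially stable» at the level
the print proves it: the reduced matrix of the linearised DAE at `(E_L^{ZI}, E_I^{ZI})` is Hurwitz).
(8) §6 is the step the print delegates to [RR:04] (Riaza 2004, «local stability of the
differential-algebraic system … may be studied by linearizing …, eliminating the algebraic equations
…, and checking that the resulting reduced matrix is Hurwitz»), PROVED here along Riaza 2008 §3.1 (the
tree's `SemiexplicitIndexOneDAE.lean` road, redone in the coordinates of (3.3)): C¹ solutions of the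
DAE (`IsDAESolutionOn`) solve the underlying ODE `Ė = dampedField(E)` obtained by differentiating the
load rows once (`hasDerivWithinAt_dampedField`; a constraint-damping term `−J_LL(E*)⁻¹f_L(E)`, zero on
solutions, is added so that the linearisation `dampedJac` is Hurwitz on the WHOLE space — it is similar
to a block-triangular matrix with diagonal blocks `−1` and the reduced matrix, `isHurwitz_dampedJac`);
`hasFDerivAt_dampedField` (product rule at a zero: `J_LL(E)⁻¹J_LI(E)` is only continuous but
multiplies `Ė_I`, which vanishes at `E*`); then Lyapunov's indirect method (the tree's
`LyapunovIndirectMethod.exists_expStable_of_matrix_eig_re_neg`, Khalil Thm. 4.7) and a first-exit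
argument keeping solutions where `J_LL` is invertible give **`theorem_3_2_locallyExpStable`**: there
are `ρ, k, λ > 0` with `‖E(t) − E*‖ ≤ k‖E(0) − E*‖e^{−λt}` for every C¹ DAE solution on `[0, T]`
starting `ρ`-close to `E* = (E_L, E_I)`.  (9) §7 (append) closes the chain FROM NETWORK DATA:
**`theorem_3_3_locallyExpStable`** (matrix-level data, as Proposition 7.2 states them) and
**`theorem_3_3_locallyExpStable_of_network`** — for a connected inductive network (`B` = the
susceptance matrix of symmetric nonnegative branch weights, companion §7 / Lemma 7.1), quadratic droop
gains `K_i < 0`, set points `E_i* > 0`, `τ_i > 0`, at least one inverter, and ZI loads with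
`−(B_red + [b_shunt]) ≻ 0` and `I_shunt > B_redE_L*` (Theorem 3.3's hypotheses), every C¹ solution
of the DAE (3.3) starting close to `(E_L^{ZI}, E_I^{ZI})` converges to it exponentially — Theorem 3.3's
«locally exponentially stable» with all matrix-level hypotheses discharged from the data (companion
`theorem_3_3_of_network`, `posDef_neg_aug_of_branchConnected`) and the DAE step of §6.  (10) §8 (append) EXISTENCE of the DAE
solutions: the damped underlying field is `C¹` on the open regular set `{det J_LL ≠ 0}`
(`contDiffOn_dampedField`), every ODE solution near `E*` obeys the estimate
(`dampedField_expStable`), hence global solutions exist from every nearby initial state (tree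
`exists_global_solution_of_confined`) and the load constraints are invariant along them (a linear
equation for the residuals, Grönwall): **`exists_daeSolution_expStable`** — from every CONSISTENT
initial condition `ρ`-close to `E*` there is a C¹ solution of (3.3) on `[0, ∞)` obeying
`‖E(t) − E*‖ ≤ k‖E(0) − E*‖e^{−λt}`; **`exists_daeSolution_expStable_of_network`** for ZI loads from
network data; and UNIQUENESS near `E*` (**`daeSolution_unique`**: two C¹ DAE solutions with the same
consistent initial condition close to `E*` coincide — Lipschitz field on the confining ball,
Grönwall).

THREE COLUMNS / WHAT IS NOT HERE.  Everything is about the MODEL of the companion file (decoupled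
reactive power flow, first-order inverter voltage sources under quadratic droop, static loads `Q_l(E_l)`
with derivative `dQ_l` at the operating point).  §1–§5 type the print's OWN criterion — the reduced
matrix of the linearised DAE is Hurwitz (with real spectrum) and the algebraic block is invertible;
§6 types the conclusion «locally exponentially stable» for C¹ solutions of the DAE (Riaza's solution
notion; load models `C¹` near the operating point: `dQf_l` a derivative function of `Q_l` near
`E_L,l`, continuous at `E_L,l`); no estimate of `ρ, k, λ` is part of the statement, and existence of
DAE solutions is not asserted (solutions are quantified over, as in the tree's Khalil Thm. 4.7).
Hypotheses as printed:
`E ∈ ℝ^{n+m}_{>0}`; `B` symmetric and `−(B_II + K_I)` positive definite (Lemma 7.1 / Proposition 7.2,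
entering as hypotheses exactly as in the companion file); `τ_i > 0`.  Nothing here says a microgrid
is stable.

## Mathlib / tree search

Tree (used by name): companion file (`closedLoop`, `Bred`, `redSource`, `invVoltage`, `jacRed`,
`ReducedPowerFlow`, `loadRow_of_invVoltage`, `BLI_conjTranspose`, `Bred_transpose`,
`isUnit_BIIK_det_of_posDef`, `theorem_3_3_ziLoads`, `ziState`, `invVoltage_pos`, `proposition_7_2`),
`LinearAlgebra/Matrix/DiagonalSymmetricProduct` (`posDef_neg_of_isHurwitz_diagonal_mul`,
`isHurwitz_diagonal_mul_of_posDef_neg`, `eig_im_eq_zero_of_diagonal_mul_symm`),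
`KineticTheory.HeatConduction.IsHurwitz`, `Analysis.ODE.exists_expStable_of_matrix_eig_re_neg`
(Khalil Thm. 4.7, `LyapunovIndirectMethod.lean`).  Mathlib: `Matrix.schur_complement_eq₁₁/₂₂`,
`IsHermitian.fromBlocks₂₂`, `hasFDerivAt_pi'`, `HasFDerivAt.mul`, `HasDerivAt.comp_hasFDerivAt`,
`continuousAt_matrix_inv`, `uniqueDiffOn_Icc`, `IsClosed.csInf_mem`, `closure_Ico`.

## References

* J. W. Simpson-Porco, F. Dörfler, F. Bullo, *Voltage stabilization in microgrids via quadratic droop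
  control*, IEEE Trans. Automat. Control 62 (2017) 1239–1253 = arXiv:1507.00431, §3.2 Theorem 3.2
  with proof (held text p0010 L17–L60), eqs. (3.9)–(3.11′). [SimpsonporcoDorflerBullo2017]
* R. A. Horn, C. R. Johnson, *Matrix Analysis*, 2nd ed., CUP 2013, §7.6 Thm. 7.6.1 (a),
  Cor. 7.6.2 (a). [HornJohnson2013]
* R. Riaza, *Differential-Algebraic Systems*, World Scientific 2008, §3.1 (the tree's
  `SemiexplicitIndexOneDAE.lean`; the print's [RR:04] is Riaza, Int. J. Circuit Theory Appl. 32
  (2004) 23–46, not held). [Riaza2008]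
* H. K. Khalil, *Nonlinear Systems*, 3rd ed., Prentice Hall 2002, Theorem 4.7 (the tree's
  `LyapunovIndirectMethod.lean`). [Khalil2002]

AI-produced formalisation (LADDER-GRIDFUSION seat gridfusion-lit-2 g12, 2026-08-28).
-/

noncomputable section

open Finset
open scoped Matrix BigOperators

namespace Literature.MathematicalPhysics.PowerSystems

open _root_.Matrix Literature.LinearAlgebra.Matrix
open Literature.MathematicalPhysics.KineticTheory.HeatConduction (IsHurwitz)

namespace QuadDroopNetwork

variable {n m : ℕ} (W : QuadDroopNetwork n m)

/-! ## §1 The Jacobian `J = [E]B + [BE] + D` of the closed loop and its symmetrisation `M` -/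

/-- The diagonal `D` of (3.11′): `D_ll = dQ_l(E_l)/dE_l` at a load bus (supplied as the number `dQ l`),
`D_ii = K_i(E_i − E_i*) + K_iE_i` at an inverter bus.
[cite: SimpsonporcoDorflerBullo2017, proof of Theorem 3.2, eq. (3.11′) («The diagonal matrix `D` … has elements `D_ii = dQ_i(E_i)/dE_i` for `i ∈ L` and `D_ii = K_i(E_i − E_i^*) + K_iE_i` for `i ∈ I`»)] -/
def jacDiag (dQ : Fin n → ℝ) (E : Fin n ⊕ Fin m → ℝ) : Fin n ⊕ Fin m → ℝ :=
  Sum.elim dQ fun i => W.K i * (E (Sum.inr i) - W.Estar i) + W.K i * E (Sum.inr i)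

/-- **The Jacobian of the closed loop (3.3)**: `J = [E]B + [BE] + D` (3.11′).
[cite: SimpsonporcoDorflerBullo2017, proof of Theorem 3.2, eq. (3.11′) («Jacobian matrix `J` of (3.3) is given by `J = [E]B + [BE] + D`»)] -/
def jac (dQ : Fin n → ℝ) (E : Fin n ⊕ Fin m → ℝ) : Matrix (Fin n ⊕ Fin m) (Fin n ⊕ Fin m) ℝ :=
  diagonal E * W.B + diagonal (W.B *ᵥ E) + diagonal (W.jacDiag dQ E)

/-- **The symmetrised Jacobian** `M = B + [E]⁻¹([BE] + D)` («we left-multiply through by `[E]⁻¹` and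
formulate the previous GEP as the symmetric GEP `Mv = λ[E]⁻¹τv`»), entrywise with division by `E_k`
(meaningful for `E ∈ ℝ^{n+m}_{>0}`).
[cite: SimpsonporcoDorflerBullo2017, proof of Theorem 3.2 («`M = Mᵀ ≜ B + [E]⁻¹([BE] + D)`»)] -/
def symJac (dQ : Fin n → ℝ) (E : Fin n ⊕ Fin m → ℝ) : Matrix (Fin n ⊕ Fin m) (Fin n ⊕ Fin m) ℝ :=
  W.B + diagonal fun k => ((W.B *ᵥ E) k + W.jacDiag dQ E k) / E k

/-- Rows of `Jh`: `(Jh)_k = E_k(Bh)_k + (BE)_kh_k + D_kh_k`.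
[cite: SimpsonporcoDorflerBullo2017, proof of Theorem 3.2, eq. (3.11′)] -/
theorem jac_mulVec_apply (dQ : Fin n → ℝ) (E h : Fin n ⊕ Fin m → ℝ) (k : Fin n ⊕ Fin m) :
    (W.jac dQ E *ᵥ h) k = E k * (W.B *ᵥ h) k + (W.B *ᵥ E) k * h k + W.jacDiag dQ E k * h k := by
  simp only [jac, add_mulVec, Pi.add_apply, ← mulVec_mulVec, mulVec_diagonal]

/-- **`J = [E]M`** for a state with nonvanishing voltages.
[cite: SimpsonporcoDorflerBullo2017, proof of Theorem 3.2 («Since `E` is strictly positive, we left-multiply through by `[E]⁻¹`»)] -/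
theorem jac_eq_diagonal_mul_symJac (dQ : Fin n → ℝ) {E : Fin n ⊕ Fin m → ℝ} (hE : ∀ k, E k ≠ 0) :
    W.jac dQ E = diagonal E * W.symJac dQ E := by
  rw [symJac, Matrix.mul_add, diagonal_mul_diagonal, jac, add_assoc, diagonal_add]
  congr 2
  funext k
  rw [mul_div_cancel₀ _ (hE k)]

variable {W} in
/-- `M` is symmetric when `B` is. [cite: SimpsonporcoDorflerBullo2017, proof of Theorem 3.2 («`M = Mᵀ`»)] -/
theorem symJac_transpose (hB : W.B.IsSymm) (dQ : Fin n → ℝ) (E : Fin n ⊕ Fin m → ℝ) :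
    (W.symJac dQ E)ᵀ = W.symJac dQ E := by
  rw [symJac, transpose_add, diagonal_transpose, hB.eq]

/-! ### `J` IS the Jacobian of the closed loop -/

/-- The linear functional `h ↦ (Bh)_k`. [folklore] -/
private def rowCLM (k : Fin n ⊕ Fin m) : (Fin n ⊕ Fin m → ℝ) →L[ℝ] ℝ :=
  (ContinuousLinearMap.proj k).comp (LinearMap.toContinuousLinearMap (Matrix.toLin' W.B))

/-- Unfolding `rowCLM`. [folklore] -/
private theorem rowCLM_apply (k : Fin n ⊕ Fin m) (h : Fin n ⊕ Fin m → ℝ) :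
    W.rowCLM k h = (W.B *ᵥ h) k := by
  simp [rowCLM, Matrix.toLin'_apply]

/-- `E ↦ (BE)_k` is linear, hence its own derivative. [folklore] -/
private theorem hasFDerivAt_Brow (k : Fin n ⊕ Fin m) (E : Fin n ⊕ Fin m → ℝ) :
    HasFDerivAt (fun E' : Fin n ⊕ Fin m → ℝ => (W.B *ᵥ E') k) (W.rowCLM k) E :=
  (W.rowCLM k).hasFDerivAt.congr_of_eventuallyEq
    (Filter.Eventually.of_forall fun E' => (W.rowCLM_apply k E').symm)

variable {W} in
/-- **`J = [E]B + [BE] + D` is the Jacobian of the closed loop (3.3)**: if each load model `Q_l` has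
derivative `dQ_l` at `E_l`, then `closedLoop` has Fréchet derivative `h ↦ J(E)h` at `E`.
[cite: SimpsonporcoDorflerBullo2017, proof of Theorem 3.2 («Jacobian matrix `J` of (3.3) is given by (3.11′)»)] -/
theorem hasFDerivAt_closedLoop {QL : Fin n → ℝ → ℝ} {dQ : Fin n → ℝ} {E : Fin n ⊕ Fin m → ℝ}
    (hQ : ∀ l, HasDerivAt (QL l) (dQ l) (E (Sum.inl l))) :
    HasFDerivAt (W.closedLoop QL)
      (LinearMap.toContinuousLinearMap (Matrix.toLin' (W.jac dQ E))) E := by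
  set L : (Fin n ⊕ Fin m → ℝ) →L[ℝ] (Fin n ⊕ Fin m → ℝ) :=
    LinearMap.toContinuousLinearMap (Matrix.toLin' (W.jac dQ E)) with hL
  have hproj : ∀ k : Fin n ⊕ Fin m, HasFDerivAt (fun E' : Fin n ⊕ Fin m → ℝ => E' k)
      (ContinuousLinearMap.proj k : (Fin n ⊕ Fin m → ℝ) →L[ℝ] ℝ) E := fun k => hasFDerivAt_apply k E
  have hLk : ∀ (k) (h : Fin n ⊕ Fin m → ℝ),
      ((ContinuousLinearMap.proj k : (Fin n ⊕ Fin m → ℝ) →L[ℝ] ℝ).comp L) h = (W.jac dQ E *ᵥ h) k := by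
    intro k h
    simp [hL, Matrix.toLin'_apply]
  rw [hasFDerivAt_pi']
  intro k
  cases k with
  | inl l =>
    -- `Q_l(E_l) + E_l(BE)_l`
    have hQ' : HasFDerivAt (fun E' : Fin n ⊕ Fin m → ℝ => QL l (E' (Sum.inl l)))
        (dQ l • (ContinuousLinearMap.proj (Sum.inl l) : (Fin n ⊕ Fin m → ℝ) →L[ℝ] ℝ)) E :=
      (hQ l).comp_hasFDerivAt E (hproj (Sum.inl l))
    have hprod := (hproj (Sum.inl l)).mul (W.hasFDerivAt_Brow (Sum.inl l) E)
    have hsum := hQ'.add hprod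
    refine (hsum.congr_of_eventuallyEq (Filter.Eventually.of_forall fun E' => ?_)).congr_fderiv ?_
    · simp only [closedLoop, Sum.elim_inl, Pi.add_apply, Pi.mul_apply]
    · ext h
      rw [hLk, jac_mulVec_apply]
      simp only [_root_.add_apply, _root_.smul_apply, ContinuousLinearMap.proj_apply, smul_eq_mul,
        rowCLM_apply, jacDiag, Sum.elim_inl]
      ring
  | inr i =>
    -- `E_iK_i(E_i − E_i*) + E_i(BE)_i`
    have h1 : HasFDerivAt (fun E' : Fin n ⊕ Fin m → ℝ => E' (Sum.inr i) * W.K i)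
        (W.K i • (ContinuousLinearMap.proj (Sum.inr i) : (Fin n ⊕ Fin m → ℝ) →L[ℝ] ℝ)) E :=
      (hproj (Sum.inr i)).mul_const (W.K i)
    have h2 : HasFDerivAt (fun E' : Fin n ⊕ Fin m → ℝ => E' (Sum.inr i) - W.Estar i)
        (ContinuousLinearMap.proj (Sum.inr i) : (Fin n ⊕ Fin m → ℝ) →L[ℝ] ℝ) E :=
      (hproj (Sum.inr i)).sub_const (W.Estar i)
    have h12 := h1.mul h2
    have hprod := (hproj (Sum.inr i)).mul (W.hasFDerivAt_Brow (Sum.inr i) E)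
    have hsum := h12.add hprod
    refine (hsum.congr_of_eventuallyEq (Filter.Eventually.of_forall fun E' => ?_)).congr_fderiv ?_
    · simp only [closedLoop, Sum.elim_inr, Pi.add_apply, Pi.mul_apply]
    · ext h
      rw [hLk, jac_mulVec_apply]
      simp only [_root_.add_apply, _root_.smul_apply, ContinuousLinearMap.proj_apply, smul_eq_mul,
        rowCLM_apply, jacDiag, Sum.elim_inr]
      ring

/-! ## §2 At an equilibrium: `M = [M₁₁ B_LI; B_IL B_II + K_I]` and the Schur complement `[E_L]⁻¹J_red` -/

/-- The state `(E_L, W₂(E_L, E_I*))` of the original network attached to load voltages `E_L`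
(Theorem 3.1: every equilibrium with positive inverter voltages is of this form).
[cite: SimpsonporcoDorflerBullo2017, §3.2 Theorem 3.1 eq. (3.8)] -/
def liftState (EL : Fin n → ℝ) : Fin n ⊕ Fin m → ℝ := Sum.elim EL (W.invVoltage EL)

/-- The `LL` block of `M` at `(E_L, W₂(E_L, E_I*))`:
`M₁₁ = [E_L]⁻¹∂Q_L/∂E_L + B_LL + [E_L]⁻¹[B_red(E_L − E_L*)]`.
[cite: SimpsonporcoDorflerBullo2017, proof of Theorem 3.2 («where `M_11 = [E_L]⁻¹(∂Q_L/∂E_L) + B_LL + [E_L]⁻¹[B_red(E_L − E_L^*)]`»)] -/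
def symJacLL (dQ EL : Fin n → ℝ) : Matrix (Fin n) (Fin n) ℝ :=
  diagonal (fun l => dQ l / EL l) + W.BLL + diagonal fun l => ((W.Bred *ᵥ EL) l - W.redSource l) / EL l

/-- **The symmetrised reduced Jacobian** `[E_L]⁻¹J_red = [E_L]⁻¹∂Q_L/∂E_L + B_red + [E_L]⁻¹[B_red(E_L − E_L*)]`
(minus the print's Schur complement (3.12′)).
[cite: SimpsonporcoDorflerBullo2017, proof of Theorem 3.2, eq. (3.12′) («which is exactly `−[E_L]⁻¹` times the Jacobian (3.9)»)] -/
def symJacRed (dQ EL : Fin n → ℝ) : Matrix (Fin n) (Fin n) ℝ :=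
  diagonal (fun l => dQ l / EL l) + W.Bred + diagonal fun l => ((W.Bred *ᵥ EL) l - W.redSource l) / EL l

/-- `J_red = [E_L]·([E_L]⁻¹J_red)` for nonvanishing load voltages.
[cite: SimpsonporcoDorflerBullo2017, proof of Theorem 3.2 («the symmetric version `[E_L]⁻¹J_red(E_L)` of (3.9)»)] -/
theorem jacRed_eq_diagonal_mul_symJacRed (dQ : Fin n → ℝ) {EL : Fin n → ℝ} (hEL : ∀ l, EL l ≠ 0) :
    W.jacRed dQ EL = diagonal EL * W.symJacRed dQ EL := by
  rw [symJacRed, Matrix.mul_add, Matrix.mul_add, diagonal_mul_diagonal, diagonal_mul_diagonal, jacRed]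
  have h1 : (fun l => EL l * (dQ l / EL l)) = dQ := by
    funext l; rw [mul_div_cancel₀ _ (hEL l)]
  have h2 : (fun l => EL l * (((W.Bred *ᵥ EL) l - W.redSource l) / EL l))
      = W.Bred *ᵥ EL - W.redSource := by
    funext l; rw [mul_div_cancel₀ _ (hEL l), Pi.sub_apply]
  rw [h1, h2]

variable {W} in
/-- `[E_L]⁻¹J_red` is symmetric when `B` is. [cite: SimpsonporcoDorflerBullo2017, proof of Theorem 3.2 («the symmetric version `[E_L]⁻¹J_red`»)] -/
theorem symJacRed_transpose (hB : W.B.IsSymm) (dQ EL : Fin n → ℝ) :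
    (W.symJacRed dQ EL)ᵀ = W.symJacRed dQ EL := by
  rw [symJacRed, transpose_add, transpose_add, diagonal_transpose, diagonal_transpose,
    Bred_transpose hB]

/-- `M₁₁ − B_LI(B_II + K_I)⁻¹B_IL = [E_L]⁻¹J_red` (definition of `B_red`).
[cite: SimpsonporcoDorflerBullo2017, proof of Theorem 3.2, eq. (3.12′)] -/
theorem symJacLL_sub (dQ EL : Fin n → ℝ) :
    W.symJacLL dQ EL - W.BLI * W.BIIK⁻¹ * W.BIL = W.symJacRed dQ EL := by
  rw [symJacLL, symJacRed, Bred]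
  abel

/-- Entries of the blocks (restated locally; the companion file keeps them private). [folklore] -/
private theorem BLL_apply' (l l' : Fin n) : W.BLL l l' = W.B (Sum.inl l) (Sum.inl l') := rfl
/-- Entries of the blocks. [folklore] -/
private theorem BLI_apply' (l : Fin n) (i : Fin m) : W.BLI l i = W.B (Sum.inl l) (Sum.inr i) := rfl
/-- Entries of the blocks. [folklore] -/
private theorem BIL_apply' (i : Fin m) (l : Fin n) : W.BIL i l = W.B (Sum.inr i) (Sum.inl l) := rfl
/-- Entries of the blocks. [folklore] -/
private theorem BII_apply' (i i' : Fin m) : W.BII i i' = W.B (Sum.inr i) (Sum.inr i') := rfl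

/-- `B` as the block matrix of its blocks. [folklore] -/
private theorem B_eq_fromBlocks' : W.B = Matrix.fromBlocks W.BLL W.BLI W.BIL W.BII :=
  (Matrix.fromBlocks_toBlocks W.B).symm

/-- Load rows of `BE` at `(E_L, W₂(E_L, E_I*))`: `(BE)_l = (B_redE_L)_l − (B_redE_L*)_l`.
[cite: SimpsonporcoDorflerBullo2017, proof of Theorem 3.1 («`[E_L]B_red(E_L − E_L^*)`»)] -/
theorem B_mulVec_liftState_inl (EL : Fin n → ℝ) (l : Fin n) :
    (W.B *ᵥ W.liftState EL) (Sum.inl l) = (W.Bred *ᵥ EL) l - W.redSource l := by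
  rw [← loadRow_of_invVoltage]
  conv_lhs => rw [B_eq_fromBlocks', liftState, Matrix.fromBlocks_mulVec]
  rfl

/-- Inverter rows of `BE` at `(E_L, W₂(E_L, E_I*))` (with `B_II + K_I` invertible):
`(BE)_i = −K_i(E_i − E_i*)` — the inverter rows of (3.3) vanish.
[cite: SimpsonporcoDorflerBullo2017, proof of Theorem 3.1, eq. (3.11) («`0 = K_I(E_I − E_I^*) + B_IIE_I + B_ILE_L`»)] -/
theorem B_mulVec_liftState_inr (hU : IsUnit W.BIIK.det) (EL : Fin n → ℝ) (i : Fin m) :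
    (W.B *ᵥ W.liftState EL) (Sum.inr i) = -(W.K i * (W.invVoltage EL i - W.Estar i)) := by
  have hI : W.BIIK *ᵥ W.invVoltage EL = diagonal W.K *ᵥ W.Estar - W.BIL *ᵥ EL := by
    rw [invVoltage, Matrix.mulVec_mulVec, Matrix.mul_nonsing_inv _ hU, Matrix.one_mulVec]
  have hi := congrFun hI i
  simp only [BIIK, Matrix.add_mulVec, Pi.add_apply, Pi.sub_apply, Matrix.mulVec_diagonal] at hi
  have hrow : (W.B *ᵥ W.liftState EL) (Sum.inr i)
      = (W.BIL *ᵥ EL) i + (W.BII *ᵥ W.invVoltage EL) i := by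
    conv_lhs => rw [B_eq_fromBlocks', liftState, Matrix.fromBlocks_mulVec]
    rfl
  rw [hrow]
  linarith

/-- **`M` at an equilibrium** `(E_L, W₂(E_L, E_I*))` with positive inverter voltages:
`M = [M₁₁ B_LI; B_IL B_II + K_I]`.
[cite: SimpsonporcoDorflerBullo2017, proof of Theorem 3.2 («one may use (3.4), (3.6), (3.8) and (3.11) to simplify `M` to `M = [M_11 B_LI; B_IL B_II + K_I]`»)] -/
theorem symJac_liftState (hU : IsUnit W.BIIK.det) (dQ : Fin n → ℝ) {EL : Fin n → ℝ}
    (hEI : ∀ i, W.invVoltage EL i ≠ 0) :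
    W.symJac dQ (W.liftState EL) = Matrix.fromBlocks (W.symJacLL dQ EL) W.BLI W.BIL W.BIIK := by
  ext k k'
  rcases k with l | i <;> rcases k' with l' | i'
  · rw [Matrix.fromBlocks_apply₁₁, symJac, Matrix.add_apply, symJacLL, Matrix.add_apply,
      Matrix.add_apply, BLL_apply']
    by_cases h : l = l'
    · subst h
      rw [diagonal_apply_eq, diagonal_apply_eq, diagonal_apply_eq, B_mulVec_liftState_inl]
      simp only [jacDiag, liftState, Sum.elim_inl]
      ring
    · rw [diagonal_apply_ne _ (fun hh => h (Sum.inl_injective hh)), diagonal_apply_ne _ h,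
        diagonal_apply_ne _ h]
      ring
  · rw [Matrix.fromBlocks_apply₁₂, symJac, Matrix.add_apply, BLI_apply',
      diagonal_apply_ne _ (by simp), add_zero]
  · rw [Matrix.fromBlocks_apply₂₁, symJac, Matrix.add_apply, BIL_apply',
      diagonal_apply_ne _ (by simp), add_zero]
  · rw [Matrix.fromBlocks_apply₂₂, symJac, Matrix.add_apply, BIIK, Matrix.add_apply, BII_apply']
    by_cases h : i = i'
    · subst h
      rw [diagonal_apply_eq, diagonal_apply_eq, B_mulVec_liftState_inr W hU]
      simp only [jacDiag, liftState, Sum.elim_inr]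
      field_simp [hEI i]
      ring
    · rw [diagonal_apply_ne _ (fun hh => h (Sum.inr_injective hh)), diagonal_apply_ne _ h, add_zero]

/-! ## §3 `J_red` Hurwitz ⇒ `−[E_L]⁻¹J_red ≻ 0` ⇒ `−M ≻ 0` ⇒ `−M_red ≻ 0` ⇒ the reduced state matrix
is Hurwitz with real spectrum -/

/-- `(−M)⁻¹ = −M⁻¹` for an invertible matrix. [folklore] -/
private theorem inv_neg_eq' {ι : Type*} [Fintype ι] [DecidableEq ι] {M : Matrix ι ι ℝ}
    (hM : IsUnit M.det) : (-M)⁻¹ = -M⁻¹ :=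
  Matrix.inv_eq_left_inv (by rw [neg_mul_neg, Matrix.nonsing_inv_mul _ hM])

/-- Invertibility of `M` from positive definiteness of `−M`. [folklore] -/
private theorem isUnit_det_of_posDef_neg' {ι : Type*} [Fintype ι] [DecidableEq ι] {M : Matrix ι ι ℝ}
    (h : (-M).PosDef) : IsUnit M.det := by
  have h1 : IsUnit (-M).det := (Matrix.isUnit_iff_isUnit_det _).1 h.isUnit
  rw [Matrix.det_neg, isUnit_iff_ne_zero, mul_ne_zero_iff] at h1
  exact isUnit_iff_ne_zero.2 h1.2

/-- **Schur-complement criterion, `₂₂` form, definite version**: `D ≻ 0` and `A − BD⁻¹Bᴴ ≻ 0` give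
`[A B; Bᴴ D] ≻ 0` («two standard results on Schur complements»). [folklore] -/
private theorem posDef_fromBlocks_of_schur₂₂ {p q : Type*} [Fintype p] [Fintype q] [DecidableEq q]
    {A : Matrix p p ℝ} {B : Matrix p q ℝ} {D : Matrix q q ℝ} (hD : D.PosDef)
    (hS : (A - B * D⁻¹ * Bᴴ).PosDef) : (Matrix.fromBlocks A B Bᴴ D).PosDef := by
  classical
  obtain ⟨hInv⟩ := hD.isUnit.nonempty_invertible
  rw [Matrix.posDef_iff_dotProduct_mulVec]
  refine ⟨(IsHermitian.fromBlocks₂₂ A B hD.1).2 hS.1, fun v hv => ?_⟩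
  rw [← Sum.elim_comp_inl_inr v, Matrix.dotProduct_mulVec,
    Matrix.schur_complement_eq₂₂ A B _ _ hD.1, ← Matrix.dotProduct_mulVec, ← Matrix.dotProduct_mulVec]
  set x : p → ℝ := v ∘ Sum.inl with hx
  set y : q → ℝ := v ∘ Sum.inr with hy
  set z : q → ℝ := (D⁻¹ * Bᴴ) *ᵥ x + y with hz
  have hDz : 0 ≤ star z ⬝ᵥ (D *ᵥ z) := by
    simpa using hD.posSemidef.dotProduct_mulVec_nonneg z
  by_cases hx0 : x = 0
  · have hy0 : y ≠ 0 := by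
      intro hy0
      apply hv
      rw [← Sum.elim_comp_inl_inr v]
      change Sum.elim x y = 0
      rw [hx0, hy0]
      funext k; cases k <;> rfl
    have hz' : z = y := by rw [hz, hx0, Matrix.mulVec_zero, zero_add]
    have hSx : star x ⬝ᵥ ((A - B * D⁻¹ * Bᴴ) *ᵥ x) = 0 := by rw [hx0]; simp
    rw [hSx, add_zero, hz']
    exact hD.dotProduct_mulVec_pos hy0
  · exact add_pos_of_nonneg_of_pos hDz (hS.dotProduct_mulVec_pos hx0)

/-- **Schur complement of a positive definite block matrix, `₁₁` form**: `[A B; Bᴴ D] ≻ 0` with `A ≻ 0`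
gives `D − BᴴA⁻¹B ≻ 0`. [folklore] -/
private theorem posDef_schur₁₁_of_posDef_fromBlocks {p q : Type*} [Fintype p] [Fintype q]
    [DecidableEq p] {A : Matrix p p ℝ} {B : Matrix p q ℝ} {D : Matrix q q ℝ} (hA : A.PosDef)
    (hM : (Matrix.fromBlocks A B Bᴴ D).PosDef) : (D - Bᴴ * A⁻¹ * B).PosDef := by
  classical
  obtain ⟨hInv⟩ := hA.isUnit.nonempty_invertible
  rw [Matrix.posDef_iff_dotProduct_mulVec]
  refine ⟨(IsHermitian.fromBlocks₁₁ B D hA.1).1 hM.1, fun y hy => ?_⟩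
  set x : p → ℝ := -((A⁻¹ * B) *ᵥ y) with hx
  have hv : Sum.elim x y ≠ 0 := by
    intro h0
    apply hy
    funext i
    exact congrFun h0 (Sum.inr i)
  have hform := (Matrix.posDef_iff_dotProduct_mulVec.1 hM).2 hv
  rw [Matrix.dotProduct_mulVec, Matrix.schur_complement_eq₁₁ B D x y hA.1] at hform
  have hzero : x + (A⁻¹ * B) *ᵥ y = 0 := by rw [hx]; abel
  rw [hzero, star_zero, Matrix.zero_vecMul, zero_dotProduct, zero_add,
    ← Matrix.dotProduct_mulVec] at hform
  exact hform

variable {W}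

/-- **Step (5): `J_red` Hurwitz forces `−[E_L]⁻¹J_red ≻ 0`** (positive load voltages, `B` symmetric):
`J_red = [E_L]·([E_L]⁻¹J_red)` with `[E_L]⁻¹J_red` symmetric, and a product `[d]S` (`d > 0`, `S`
symmetric) is Hurwitz only if `−S ≻ 0` (Horn–Johnson Thm. 7.6.1 (a)).  The print reaches the same
conclusion through «`−J` is an `M`-matrix and is therefore `D`-stable»; no sign hypothesis on the
off-diagonal entries is needed on this road.
[cite: SimpsonporcoDorflerBullo2017, proof of Theorem 3.2 («Since `J_red` is Hurwitz … It follows that the Schur complement (3.12′) is positive definite»); HornJohnson2013, §7.6 Thm. 7.6.1 (a)] -/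
theorem posDef_neg_symJacRed_of_isHurwitz (hB : W.B.IsSymm) {dQ EL : Fin n → ℝ}
    (hEL : ∀ l, 0 < EL l) (hH : IsHurwitz (W.jacRed dQ EL)) : (-W.symJacRed dQ EL).PosDef := by
  rw [jacRed_eq_diagonal_mul_symJacRed W dQ (fun l => (hEL l).ne')] at hH
  exact posDef_neg_of_isHurwitz_diagonal_mul hEL (symJacRed_transpose hB dQ EL) hH

/-- **Step (5), continued: `−M ≻ 0`** at the equilibrium `(E_L, W₂(E_L, E_I*))` with positive
voltages, `B` symmetric, `−(B_II + K_I) ≻ 0` and `J_red(E_L)` Hurwitz — «`−M` will be positive definite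
if and only if the Schur complement with respect to this bottom-right block is also positive definite».
[cite: SimpsonporcoDorflerBullo2017, proof of Theorem 3.2 («Since the bottom-right block `−(B_II + K_I)` of `−M` is positive definite, `−M` will be positive definite if and only if the Schur complement … is also positive definite»)] -/
theorem posDef_neg_symJac (hB : W.B.IsSymm) (hII : (-W.BIIK).PosDef) {dQ EL : Fin n → ℝ}
    (hEL : ∀ l, 0 < EL l) (hEI : ∀ i, 0 < W.invVoltage EL i) (hH : IsHurwitz (W.jacRed dQ EL)) :
    (-W.symJac dQ (W.liftState EL)).PosDef := by
  classical
  have hU : IsUnit W.BIIK.det := isUnit_BIIK_det_of_posDef hII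
  have hS := posDef_neg_symJacRed_of_isHurwitz hB hEL hH
  rw [symJac_liftState W hU dQ (fun i => (hEI i).ne'), Matrix.fromBlocks_neg]
  have hLIH : (-W.BLI)ᴴ = -W.BIL := by rw [conjTranspose_neg, BLI_conjTranspose hB]
  rw [← hLIH]
  refine posDef_fromBlocks_of_schur₂₂ hII ?_
  have hschur : -W.symJacLL dQ EL - -W.BLI * (-W.BIIK)⁻¹ * (-W.BLI)ᴴ = -W.symJacRed dQ EL := by
    rw [hLIH, inv_neg_eq' hU, ← symJacLL_sub]
    simp only [Matrix.neg_mul, Matrix.mul_neg, neg_neg]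
    abel
  rw [hschur]
  exact hS

/-- **Index one: the algebraic equations can be eliminated.**  Under the same hypotheses the `LL`
block `J_LL = [E_L]M₁₁` of the Jacobian is invertible (`−M₁₁ ≻ 0` as a principal block of `−M ≻ 0`).
[cite: SimpsonporcoDorflerBullo2017, proof of Theorem 3.2 («eliminating the algebraic equations from the system matrix»); Riaza2008, §3.1 («If the derivative `g_z(y*,z*)` defines an invertible matrix … index one»)] -/
theorem posDef_neg_symJacLL (hB : W.B.IsSymm) (hII : (-W.BIIK).PosDef) {dQ EL : Fin n → ℝ}
    (hEL : ∀ l, 0 < EL l) (hEI : ∀ i, 0 < W.invVoltage EL i) (hH : IsHurwitz (W.jacRed dQ EL)) :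
    (-W.symJacLL dQ EL).PosDef := by
  have hM := posDef_neg_symJac hB hII hEL hEI hH
  have hU : IsUnit W.BIIK.det := isUnit_BIIK_det_of_posDef hII
  rw [symJac_liftState W hU dQ (fun i => (hEI i).ne'), Matrix.fromBlocks_neg] at hM
  have h := hM.submatrix Sum.inl_injective
  have hsub : (Matrix.fromBlocks (-W.symJacLL dQ EL) (-W.BLI) (-W.BIL) (-W.BIIK)).submatrix
      Sum.inl Sum.inl = -W.symJacLL dQ EL := by
    ext l l'
    rw [Matrix.submatrix_apply, Matrix.fromBlocks_apply₁₁]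
  rw [hsub] at h
  exact h

variable (W) in
/-- The blocks of the Jacobian `J` (loads `L` = algebraic variables, inverters `I` = dynamic
variables). [cite: SimpsonporcoDorflerBullo2017, proof of Theorem 3.2 («Partitioning … block partitioning `M`»)] -/
def jacLL (dQ : Fin n → ℝ) (E : Fin n ⊕ Fin m → ℝ) : Matrix (Fin n) (Fin n) ℝ := (W.jac dQ E).toBlocks₁₁
/-- The `LI` block of `J`. [cite: SimpsonporcoDorflerBullo2017, proof of Theorem 3.2] -/
def jacLI (dQ : Fin n → ℝ) (E : Fin n ⊕ Fin m → ℝ) : Matrix (Fin n) (Fin m) ℝ := (W.jac dQ E).toBlocks₁₂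
/-- The `IL` block of `J`. [cite: SimpsonporcoDorflerBullo2017, proof of Theorem 3.2] -/
def jacIL (dQ : Fin n → ℝ) (E : Fin n ⊕ Fin m → ℝ) : Matrix (Fin m) (Fin n) ℝ := (W.jac dQ E).toBlocks₂₁
/-- The `II` block of `J`. [cite: SimpsonporcoDorflerBullo2017, proof of Theorem 3.2] -/
def jacII (dQ : Fin n → ℝ) (E : Fin n ⊕ Fin m → ℝ) : Matrix (Fin m) (Fin m) ℝ := (W.jac dQ E).toBlocks₂₂

variable (W) in
/-- **The reduced matrix of the linearised DAE** — linearise (3.3) at `E`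
(`0 = J_LLx_L + J_LIx_I`, `τ_Iẋ_I = J_ILx_L + J_IIx_I`), eliminate the algebraic variables
(`x_L = −J_LL⁻¹J_LIx_I`): `ẋ_I = τ_I⁻¹(J_II − J_ILJ_LL⁻¹J_LI)x_I`.
[cite: SimpsonporcoDorflerBullo2017, proof of Theorem 3.2 («linearizing the differential algebraic system, eliminating the algebraic equations from the system matrix, and checking that the resulting reduced matrix is Hurwitz»)] -/
def redStateMatrix (dQ : Fin n → ℝ) (E : Fin n ⊕ Fin m → ℝ) : Matrix (Fin m) (Fin m) ℝ :=
  diagonal (fun i => (W.τ i)⁻¹) *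
    (W.jacII dQ E - W.jacIL dQ E * (W.jacLL dQ E)⁻¹ * W.jacLI dQ E)

variable (W) in
/-- `M_red = M_II − M_IL M_LL⁻¹ M_LI = (B_II + K_I) − B_IL M₁₁⁻¹ B_LI` at `(E_L, W₂(E_L, E_I*))`.
[cite: SimpsonporcoDorflerBullo2017, proof of Theorem 3.2 («`M_red = M_redᵀ ≜ M_II − M_IL M_LL⁻¹ M_LI`»)] -/
def Mred (dQ EL : Fin n → ℝ) : Matrix (Fin m) (Fin m) ℝ :=
  W.BIIK - W.BIL * (W.symJacLL dQ EL)⁻¹ * W.BLI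

/-- The blocks of `J = [E]M` at `(E_L, W₂(E_L, E_I*))`: `J_LL = [E_L]M₁₁`, `J_LI = [E_L]B_LI`,
`J_IL = [E_I]B_IL`, `J_II = [E_I](B_II + K_I)`. [cite: SimpsonporcoDorflerBullo2017, proof of Theorem 3.2 («block partitioning `M`»)] -/
theorem jac_liftState_blocks (hU : IsUnit W.BIIK.det) (dQ : Fin n → ℝ) {EL : Fin n → ℝ}
    (hEL : ∀ l, EL l ≠ 0) (hEI : ∀ i, W.invVoltage EL i ≠ 0) :
    W.jacLL dQ (W.liftState EL) = diagonal EL * W.symJacLL dQ EL ∧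
      W.jacLI dQ (W.liftState EL) = diagonal EL * W.BLI ∧
      W.jacIL dQ (W.liftState EL) = diagonal (W.invVoltage EL) * W.BIL ∧
      W.jacII dQ (W.liftState EL) = diagonal (W.invVoltage EL) * W.BIIK := by
  have hE : ∀ k, W.liftState EL k ≠ 0 := by
    intro k; cases k with
    | inl l => exact hEL l
    | inr i => exact hEI i
  have hJ : W.jac dQ (W.liftState EL)
      = Matrix.fromBlocks (diagonal EL * W.symJacLL dQ EL) (diagonal EL * W.BLI)
          (diagonal (W.invVoltage EL) * W.BIL) (diagonal (W.invVoltage EL) * W.BIIK) := by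
    rw [jac_eq_diagonal_mul_symJac W dQ hE, symJac_liftState W hU dQ hEI]
    have hdiag : diagonal (W.liftState EL)
        = Matrix.fromBlocks (diagonal EL) 0 0 (diagonal (W.invVoltage EL)) := by
      rw [liftState, ← Matrix.fromBlocks_diagonal]
    rw [hdiag, Matrix.fromBlocks_multiply]
    simp
  refine ⟨?_, ?_, ?_, ?_⟩
  · rw [jacLL, hJ, Matrix.toBlocks_fromBlocks₁₁]
  · rw [jacLI, hJ, Matrix.toBlocks_fromBlocks₁₂]
  · rw [jacIL, hJ, Matrix.toBlocks_fromBlocks₂₁]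
  · rw [jacII, hJ, Matrix.toBlocks_fromBlocks₂₂]

/-- **Step (6), the reduced matrix in symmetric form**: at `(E_L, W₂(E_L, E_I*))` with nonvanishing
voltages and `M₁₁` invertible, `τ_I⁻¹(J_II − J_ILJ_LL⁻¹J_LI) = [E_I/τ_I]·M_red` — the reduced GEP
`M_redv_I = λ[E_I]⁻¹τ_Iv_I`.
[cite: SimpsonporcoDorflerBullo2017, proof of Theorem 3.2 («we arrive at a reduced GEP `M_red v_I = λ[E_I]⁻¹τ_I v_I`»)] -/
theorem redStateMatrix_liftState (hU : IsUnit W.BIIK.det) (dQ : Fin n → ℝ) {EL : Fin n → ℝ}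
    (hEL : ∀ l, EL l ≠ 0) (hEI : ∀ i, W.invVoltage EL i ≠ 0) :
    W.redStateMatrix dQ (W.liftState EL)
      = diagonal (fun i => W.invVoltage EL i / W.τ i) * W.Mred dQ EL := by
  obtain ⟨h11, h12, h21, h22⟩ := jac_liftState_blocks hU dQ hEL hEI
  have hdiagL : IsUnit (diagonal EL).det := by
    rw [det_diagonal, isUnit_iff_ne_zero]
    exact Finset.prod_ne_zero_iff.2 fun l _ => hEL l
  rw [redStateMatrix, h11, h12, h21, h22, Mred, Matrix.mul_inv_rev]
  -- `[E_I]B_IL · (M₁₁⁻¹[E_L]⁻¹) · [E_L]B_LI = [E_I](B_IL M₁₁⁻¹ B_LI)`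
  have hmid : diagonal (W.invVoltage EL) * W.BIL * ((W.symJacLL dQ EL)⁻¹ * (diagonal EL)⁻¹)
        * (diagonal EL * W.BLI)
      = diagonal (W.invVoltage EL) * (W.BIL * (W.symJacLL dQ EL)⁻¹ * W.BLI) := by
    simp only [Matrix.mul_assoc]
    rw [← Matrix.mul_assoc (diagonal EL)⁻¹, Matrix.nonsing_inv_mul _ hdiagL, Matrix.one_mul]
  rw [hmid, ← Matrix.mul_sub, ← Matrix.mul_assoc, diagonal_mul_diagonal]
  congr 2
  funext i
  rw [div_eq_inv_mul]

/-- **Step (5)–(6): `−M_red ≻ 0`** («hence that `M_red` is [negative] definite») at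
`(E_L, W₂(E_L, E_I*))` with positive voltages, `B` symmetric, `−(B_II + K_I) ≻ 0`, `J_red(E_L)` Hurwitz:
`−M_red` is the Schur complement of `−M ≻ 0` with respect to its `LL` block.
[cite: SimpsonporcoDorflerBullo2017, proof of Theorem 3.2 («`λ_i < 0` for each `i ∈ I` if and only if `M_red` is negative definite. We now show indirectly that `−M_red` is positive definite»)] -/
theorem posDef_neg_Mred (hB : W.B.IsSymm) (hII : (-W.BIIK).PosDef) {dQ EL : Fin n → ℝ}
    (hEL : ∀ l, 0 < EL l) (hEI : ∀ i, 0 < W.invVoltage EL i) (hH : IsHurwitz (W.jacRed dQ EL)) :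
    (-W.Mred dQ EL).PosDef := by
  classical
  have hM := posDef_neg_symJac hB hII hEL hEI hH
  have hLL := posDef_neg_symJacLL hB hII hEL hEI hH
  have hU : IsUnit W.BIIK.det := isUnit_BIIK_det_of_posDef hII
  have hULL : IsUnit (W.symJacLL dQ EL).det := isUnit_det_of_posDef_neg' hLL
  rw [symJac_liftState W hU dQ (fun i => (hEI i).ne'), Matrix.fromBlocks_neg] at hM
  have hLIH : (-W.BLI)ᴴ = -W.BIL := by rw [conjTranspose_neg, BLI_conjTranspose hB]
  rw [← hLIH] at hM
  have hS := posDef_schur₁₁_of_posDef_fromBlocks hLL hM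
  have hform : -W.BIIK - (-W.BLI)ᴴ * (-W.symJacLL dQ EL)⁻¹ * -W.BLI = -W.Mred dQ EL := by
    rw [hLIH, inv_neg_eq' hULL, Mred]
    simp only [Matrix.neg_mul, Matrix.mul_neg, neg_neg]
    abel
  rw [hform] at hS
  exact hS

/-- `M_red` is symmetric (`B` symmetric). [cite: SimpsonporcoDorflerBullo2017, proof of Theorem 3.2 («`M_red = M_redᵀ`»)] -/
theorem Mred_transpose (hB : W.B.IsSymm) (dQ EL : Fin n → ℝ) : (W.Mred dQ EL)ᵀ = W.Mred dQ EL := by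
  have hLL : (W.symJacLL dQ EL)ᵀ = W.symJacLL dQ EL := by
    have hBLL : W.BLLᵀ = W.BLL := by
      ext l l'; rw [transpose_apply, BLL_apply', BLL_apply']; exact hB.apply _ _
    rw [symJacLL, transpose_add, transpose_add, diagonal_transpose, diagonal_transpose, hBLL]
  have hBII : W.BIIᵀ = W.BII := by
    ext i i'; rw [transpose_apply, BII_apply', BII_apply']; exact hB.apply _ _
  have hIIK : W.BIIKᵀ = W.BIIK := by
    rw [BIIK, transpose_add, hBII, diagonal_transpose]
  have hLI : W.BLIᵀ = W.BIL := by
    rw [← conjTranspose_eq_transpose_of_trivial]; exact BLI_conjTranspose hB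
  have hIL : W.BILᵀ = W.BLI := by
    rw [← hLI, transpose_transpose]
  rw [Mred, transpose_sub, transpose_mul, transpose_mul, hIIK, hLI, hIL, transpose_nonsing_inv, hLL,
    Matrix.mul_assoc]

/-- **Theorem 3.2, the reduced matrix is Hurwitz.**  At the equilibrium `(E_L, E_I) = (E_L, W₂(E_L, E_I*))`
of (3.3) with `E ∈ ℝ^{n+m}_{>0}`, `B` symmetric, `−(B_II + K_I) ≻ 0` (Lemma 7.1 / Prop. 7.2) and
`τ_i > 0`: if `J_red(E_L)` is Hurwitz then the reduced matrix `τ_I⁻¹(J_II − J_ILJ_LL⁻¹J_LI)` of the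
linearised differential-algebraic closed loop is Hurwitz («checking that the resulting reduced matrix
is Hurwitz» — here: `= [E_I/τ_I]M_red` with `−M_red ≻ 0`, Horn–Johnson Thm. 7.6.1 (a)).
[cite: SimpsonporcoDorflerBullo2017, §3.2 Theorem 3.2 («If the Jacobian of the reduced power flow equation … is a Hurwitz matrix … then the equilibrium point `(E_L, E_I)` of the differential-algebraic system (3.3) is locally exponentially stable») and its proof; HornJohnson2013, §7.6 Thm. 7.6.1 (a)] -/
theorem redStateMatrix_isHurwitz (hB : W.B.IsSymm) (hII : (-W.BIIK).PosDef) (hτ : ∀ i, 0 < W.τ i)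
    {dQ EL : Fin n → ℝ} (hEL : ∀ l, 0 < EL l) (hEI : ∀ i, 0 < W.invVoltage EL i)
    (hH : IsHurwitz (W.jacRed dQ EL)) : IsHurwitz (W.redStateMatrix dQ (W.liftState EL)) := by
  have hU : IsUnit W.BIIK.det := isUnit_BIIK_det_of_posDef hII
  rw [redStateMatrix_liftState hU dQ (fun l => (hEL l).ne') (fun i => (hEI i).ne')]
  exact isHurwitz_diagonal_mul_of_posDef_neg (fun i => div_pos (hEI i) (hτ i))
    (posDef_neg_Mred hB hII hEL hEI hH)

/-- **Theorem 3.2, real spectrum of the reduced GEP**: at `(E_L, W₂(E_L, E_I*))` with nonvanishing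
load voltages, positive inverter voltages, `τ_i > 0`, `B` symmetric and `B_II + K_I` invertible, every
complex eigenvalue of the reduced matrix `[E_I/τ_I]M_red` is real («The eigenvalues … of this reduced
GEP are therefore real»). [cite: SimpsonporcoDorflerBullo2017, proof of Theorem 3.2 («The matrices on both sides are symmetric … The eigenvalues … are therefore real»); HornJohnson2013, §7.6 Cor. 7.6.2 (a)] -/
theorem redStateMatrix_eig_real (hB : W.B.IsSymm) (hU : IsUnit W.BIIK.det) (hτ : ∀ i, 0 < W.τ i)
    {dQ EL : Fin n → ℝ} (hEL : ∀ l, EL l ≠ 0) (hEI : ∀ i, 0 < W.invVoltage EL i)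
    {μ : ℂ} {v : Fin m → ℂ} (hv : v ≠ 0)
    (hμ : ((W.redStateMatrix dQ (W.liftState EL)).map (algebraMap ℝ ℂ)) *ᵥ v = μ • v) : μ.im = 0 := by
  rw [redStateMatrix_liftState hU dQ hEL (fun i => (hEI i).ne')] at hμ
  refine eig_im_eq_zero_of_diagonal_mul_symm (fun i => div_pos (hEI i) (hτ i)) ?_ hv hμ
  exact Mred_transpose hB dQ EL

/-- **Index one at the equilibrium**: `J_LL` is invertible, so the linearised algebraic equations
`0 = J_LLx_L + J_LIx_I` determine `x_L` («eliminating the algebraic equations from the system matrix»).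
[cite: SimpsonporcoDorflerBullo2017, proof of Theorem 3.2; Riaza2008, §3.1 (index one)] -/
theorem isUnit_jacLL_det (hB : W.B.IsSymm) (hII : (-W.BIIK).PosDef) {dQ EL : Fin n → ℝ}
    (hEL : ∀ l, 0 < EL l) (hEI : ∀ i, 0 < W.invVoltage EL i) (hH : IsHurwitz (W.jacRed dQ EL)) :
    IsUnit (W.jacLL dQ (W.liftState EL)).det := by
  have hU : IsUnit W.BIIK.det := isUnit_BIIK_det_of_posDef hII
  obtain ⟨h11, -, -, -⟩ := jac_liftState_blocks hU dQ (fun l => (hEL l).ne') (fun i => (hEI i).ne')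
  rw [h11, det_mul, det_diagonal, IsUnit.mul_iff]
  exact ⟨isUnit_iff_ne_zero.2 (Finset.prod_ne_zero_iff.2 fun l _ => (hEL l).ne'),
    isUnit_det_of_posDef_neg' (posDef_neg_symJacLL hB hII hEL hEI hH)⟩

/-! ## §4 The sufficient condition (3.10): `∂Q_l/∂E_l ≤ 0` and `B_red ≺ [E_L]⁻²[Q_L(E_L)]` ⇒ `J_red`
Hurwitz -/

/-- **`[E_L]⁻¹J_red = [E_L]⁻¹∂Q_L/∂E_L + B_red − [E_L]⁻²[Q_L(E_L)]` at a solution of the reduced power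
flow equation** («Solving (3.7) for `B_red(E_L − E_L*)` and substituting into the third term»).
[cite: SimpsonporcoDorflerBullo2017, proof of Theorem 3.2, «moreover» part] -/
theorem symJacRed_of_reducedPowerFlow {QL : Fin n → ℝ → ℝ} (dQ : Fin n → ℝ) {EL : Fin n → ℝ}
    (hEL : ∀ l, EL l ≠ 0) (hR : W.ReducedPowerFlow QL EL) :
    W.symJacRed dQ EL
      = diagonal (fun l => dQ l / EL l) + W.Bred - diagonal fun l => QL l (EL l) / EL l ^ 2 := by
  rw [symJacRed, sub_eq_add_neg, diagonal_neg]
  congr 2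
  funext l
  have hl := hR l
  have hsol : (W.Bred *ᵥ EL) l - W.redSource l = -(QL l (EL l) / EL l) := by
    field_simp [hEL l]
    linarith
  rw [hsol]
  field_simp [hEL l]

/-- **Theorem 3.2, «moreover» — the sufficient condition (3.10).**  At a solution `E_L ∈ ℝ^n_{>0}` of the
reduced power flow equation with load derivatives `∂Q_l/∂E_l ≤ 0`, if `B_red ≺ [E_L]⁻²[Q_L(E_L)]`
(i.e. `[E_L]⁻²[Q_L(E_L)] − B_red ≻ 0`) then `J_red(E_L)` is Hurwitz: `−[E_L]⁻¹J_red =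
[E_L]⁻¹(−∂Q_L/∂E_L) + ([E_L]⁻²[Q_L] − B_red) ≻ 0` and `J_red = [E_L]·([E_L]⁻¹J_red)`.
[cite: SimpsonporcoDorflerBullo2017, §3.2 Theorem 3.2 («Moreover, assuming that `∂Q_i(E_i)/∂E_i ≤ 0` … a sufficient condition for (3.9) to be Hurwitz is that `B_red ≺ [E_L]⁻²[Q_L(E_L)]`», eq. (3.10)) and its proof («The first term is diagonal and by assumption negative semidefinite, and hence `J_red(E_L)` will be Hurwitz if (3.10) holds»); HornJohnson2013, §7.6 Thm. 7.6.1 (a)] -/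
theorem jacRed_isHurwitz_of_Bred_lt {QL : Fin n → ℝ → ℝ} {dQ EL : Fin n → ℝ} (hEL : ∀ l, 0 < EL l)
    (hR : W.ReducedPowerFlow QL EL) (hdQ : ∀ l, dQ l ≤ 0)
    (hcond : (diagonal (fun l => QL l (EL l) / EL l ^ 2) - W.Bred).PosDef) :
    IsHurwitz (W.jacRed dQ EL) := by
  have hEL' : ∀ l, EL l ≠ 0 := fun l => (hEL l).ne'
  rw [jacRed_eq_diagonal_mul_symJacRed W dQ hEL']
  refine isHurwitz_diagonal_mul_of_posDef_neg hEL ?_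
  rw [symJacRed_of_reducedPowerFlow dQ hEL' hR]
  have hform : -(diagonal (fun l => dQ l / EL l) + W.Bred - diagonal fun l => QL l (EL l) / EL l ^ 2)
      = (diagonal (fun l => QL l (EL l) / EL l ^ 2) - W.Bred) + diagonal fun l => -(dQ l / EL l) := by
    ext i j
    simp only [Matrix.neg_apply, Matrix.add_apply, Matrix.sub_apply, diagonal_apply]
    split_ifs <;> ring
  rw [hform]
  refine hcond.add_posSemidef (PosSemidef.diagonal fun l => ?_)
  exact neg_nonneg.2 (div_nonpos_of_nonpos_of_nonneg (hdQ l) (hEL l).le)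

/-! ## §5 Assembly: Theorem 3.2 (reduced-matrix form) and the ZI-load instance of Theorem 3.3 -/

/-- **Theorem 3.2 (Stability from Reduced Jacobian), reduced-matrix form, assembled.**  Data: `B`
symmetric, `−(B_II + K_I) ≻ 0`, `τ_i > 0`; a solution `E_L ∈ ℝ^n_{>0}` of the reduced power flow
equation (3.7) whose recovered inverter voltages `E_I = W₂(E_L, E_I*)` are positive; `dQ_l` the load
derivatives at `E_L` (the entries `D_ll` of (3.11′)).  If `J_red(E_L)` is Hurwitz then: (i) `(E_L, E_I)`
is an equilibrium of the closed loop (3.3) in `ℝ^{n+m}_{>0}`; (ii) `J = [E]B + [BE] + D` is the Jacobian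
of (3.3) there whenever `Q_l'(E_l) = dQ_l`; (iii) the algebraic block `J_LL` is invertible; (iv) the
reduced matrix `τ_I⁻¹(J_II − J_ILJ_LL⁻¹J_LI)` of the linearised DAE is Hurwitz, (v) with real spectrum.
MODEL: as in the companion file; the step from (iii)–(iv) to exponential decay of nearby DAE solutions
([RR:04]) is not typed here.
[cite: SimpsonporcoDorflerBullo2017, §3.2 Theorem 3.2 and its proof] -/
theorem theorem_3_2_reducedStateMatrix (hB : W.B.IsSymm) (hII : (-W.BIIK).PosDef)
    (hτ : ∀ i, 0 < W.τ i) {QL : Fin n → ℝ → ℝ} {dQ EL : Fin n → ℝ} (hEL : ∀ l, 0 < EL l)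
    (hEI : ∀ i, 0 < W.invVoltage EL i) (hR : W.ReducedPowerFlow QL EL)
    (hH : IsHurwitz (W.jacRed dQ EL)) :
    (W.IsEquilibrium QL (W.liftState EL) ∧ ∀ k, 0 < W.liftState EL k) ∧
      ((∀ l, HasDerivAt (QL l) (dQ l) (EL l)) → HasFDerivAt (W.closedLoop QL)
        (LinearMap.toContinuousLinearMap (Matrix.toLin' (W.jac dQ (W.liftState EL))))
          (W.liftState EL)) ∧
      IsUnit (W.jacLL dQ (W.liftState EL)).det ∧
      IsHurwitz (W.redStateMatrix dQ (W.liftState EL)) ∧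
      ∀ (μ : ℂ) (v : Fin m → ℂ), v ≠ 0 →
        ((W.redStateMatrix dQ (W.liftState EL)).map (algebraMap ℝ ℂ)) *ᵥ v = μ • v → μ.im = 0 := by
  have hU : IsUnit W.BIIK.det := isUnit_BIIK_det_of_posDef hII
  refine ⟨⟨isEquilibrium_of_reducedPowerFlow hU hR, fun k => ?_⟩, fun hQ => ?_,
    isUnit_jacLL_det hB hII hEL hEI hH, redStateMatrix_isHurwitz hB hII hτ hEL hEI hH,
    fun μ v hv hμ => redStateMatrix_eig_real hB hU hτ (fun l => (hEL l).ne') hEI hv hμ⟩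
  · cases k with
    | inl l => exact hEL l
    | inr i => exact hEI i
  · exact hasFDerivAt_closedLoop fun l => hQ l

/-- `−(B_II + K_I) ≻ 0` from `−(B + blkdiag(0, K_I)) ≻ 0` (a principal block) — the companion file's
recurring step, recorded once. [cite: SimpsonporcoDorflerBullo2017, §7 Lemma 7.1 (iii) and Proposition 7.2] -/
theorem posDef_neg_BIIK_of_posDef_aug
    (hM : (-(W.B + Matrix.fromBlocks 0 0 0 (diagonal W.K))).PosDef) : (-W.BIIK).PosDef := by
  have h := hM.submatrix Sum.inr_injective
  have hsub : (-(W.B + Matrix.fromBlocks 0 0 0 (diagonal W.K))).submatrix Sum.inr Sum.inr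
      = -W.BIIK := by
    ext i i'
    simp [Matrix.submatrix_apply, Matrix.fromBlocks_apply₂₂, BIIK, BII_apply', Matrix.diagonal_apply]
  rw [← hsub]; exact h

/-- **Theorem 3.3 (ZI loads), linearised-DAE conclusion.**  Under the data hypotheses of Proposition 7.2
(`B` symmetric, off-diagonal entries `≥ 0`, zero row sums, `−(B + blkdiag(0, K_I)) ≻ 0`, `K_i ≤ 0`,
`E_i* > 0`, `τ_i > 0`) and (i) `−(B_red + [b_shunt])` Stieltjes, (ii) `I_shunt > B_redE_L*`: at the
equilibrium `(E_L^{ZI}, E_I^{ZI})` of the closed loop with ZI loads `Q_l(E_l) = b_lE_l² + I_lE_l`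
(`Q_l' = 2b_lE_l + I_l`), `J` is the Jacobian of (3.3), `J_LL` is invertible and the reduced matrix of
the linearised DAE is Hurwitz — the companion file's `theorem_3_3_originalNetwork` pushed through
Theorem 3.2 («the associated equilibrium point … is locally exponentially stable», at the level the
print proves it).
[cite: SimpsonporcoDorflerBullo2017, §3.3 Theorem 3.3 («locally exponentially stable») with §3.2 Theorem 3.2 and §7 Proposition 7.2] -/
theorem theorem_3_3_redStateMatrix_isHurwitz {bsh Ish : Fin n → ℝ} (hB : W.B.IsSymm)
    (hoff : ∀ k k', k ≠ k' → 0 ≤ W.B k k') (hrowB : ∀ k, ∑ k', W.B k k' = 0)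
    (hM : (-(W.B + Matrix.fromBlocks 0 0 0 (diagonal W.K))).PosDef) (hK : ∀ i, W.K i ≤ 0)
    (hE : ∀ i, 0 < W.Estar i) (hτ : ∀ i, 0 < W.τ i) (hA : (-(W.Bred + diagonal bsh)).PosDef)
    (hZ : IsZMatrix (-(W.Bred + diagonal bsh))) (hI : ∀ l, W.redSource l < Ish l) :
    let dQ : Fin n → ℝ := fun l => 2 * bsh l * W.ziVoltage bsh Ish l + Ish l
    HasFDerivAt (W.closedLoop (ziLoad bsh Ish))
        (LinearMap.toContinuousLinearMap (Matrix.toLin' (W.jac dQ (W.ziState bsh Ish))))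
        (W.ziState bsh Ish) ∧
      IsUnit (W.jacLL dQ (W.ziState bsh Ish)).det ∧
      IsHurwitz (W.redStateMatrix dQ (W.ziState bsh Ish)) := by
  intro dQ
  obtain ⟨-, -, ⟨hW2, hW2one⟩, -⟩ := proposition_7_2 hB hoff hrowB hM hK hE
  obtain ⟨hpos, -, -, hHur⟩ := theorem_3_3_ziLoads hA hZ hI
  have hII := posDef_neg_BIIK_of_posDef_aug hM
  have hEI : ∀ i, 0 < W.invVoltage (W.ziVoltage bsh Ish) i :=
    fun i => invVoltage_pos hW2 hW2one hE hpos i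
  have hstate : W.ziState bsh Ish = W.liftState (W.ziVoltage bsh Ish) := rfl
  have hQ : ∀ l, HasDerivAt (ziLoad bsh Ish l) (dQ l) (W.ziVoltage bsh Ish l) := by
    intro l
    have h1 := ((hasDerivAt_id (W.ziVoltage bsh Ish l)).pow 2).const_mul (bsh l)
    have h2 := (hasDerivAt_id (W.ziVoltage bsh Ish l)).const_mul (Ish l)
    refine ((h1.add h2).congr_of_eventuallyEq (Filter.Eventually.of_forall fun e => ?_)).congr_deriv ?_
    · simp [ziLoad]
    · simp [dQ]
      ring
  rw [hstate]
  exact ⟨hasFDerivAt_closedLoop fun l => hQ l, isUnit_jacLL_det hB hII hpos hEI hHur,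
    redStateMatrix_isHurwitz hB hII hτ hpos hEI hHur⟩

/-! ## §6 The differential-algebraic step ([RR:04] / Riaza): nearby C¹ solutions of (3.3) decay
exponentially -/

section DAE

open Filter Asymptotics Set
open scoped Topology

/-! ### Generic helpers -/


/-- Product rule at a zero: `Φ` continuous at `x₀`, `ψ` differentiable at `x₀` with `ψ x₀ = 0` ⇒
`Φ·ψ` is differentiable at `x₀` with derivative `Φ(x₀)·ψ'`. [folklore] -/
private theorem hasFDerivAt_mul_of_continuousAt_of_eq_zero {X : Type*} [NormedAddCommGroup X]
    [NormedSpace ℝ X] {Φ ψ : X → ℝ} {x₀ : X} {ψ' : X →L[ℝ] ℝ} (hΦ : ContinuousAt Φ x₀)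
    (hψ : HasFDerivAt ψ ψ' x₀) (h0 : ψ x₀ = 0) :
    HasFDerivAt (fun x => Φ x * ψ x) (Φ x₀ • ψ') x₀ := by
  refine HasFDerivAt.of_isLittleO ?_
  have hdec : (fun x => Φ x * ψ x - Φ x₀ * ψ x₀ - (Φ x₀ • ψ') (x - x₀))
      = fun x => (Φ x - Φ x₀) * ψ x + Φ x₀ * (ψ x - ψ x₀ - ψ' (x - x₀)) := by
    funext x
    rw [_root_.smul_apply, smul_eq_mul, h0]
    ring
  rw [hdec]
  have hΦ0 : (fun x => Φ x - Φ x₀) =o[𝓝 x₀] fun _ => (1 : ℝ) := by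
    rw [isLittleO_one_iff]
    have := hΦ.tendsto.sub_const (Φ x₀)
    simpa using this
  have hψO : ψ =O[𝓝 x₀] fun x => ‖x - x₀‖ := by
    have := hψ.isBigO_sub
    simp only [h0, sub_zero] at this
    exact this.norm_right
  have h1 : (fun x => (Φ x - Φ x₀) * ψ x) =o[𝓝 x₀] fun x => x - x₀ := by
    have := hΦ0.mul_isBigO hψO
    refine IsLittleO.of_norm_right ?_
    refine this.congr_right fun x => ?_
    rw [one_mul]
  have h2 : (fun x => Φ x₀ * (ψ x - ψ x₀ - ψ' (x - x₀))) =o[𝓝 x₀] fun x => x - x₀ :=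
    hψ.isLittleO.const_mul_left (Φ x₀)
  exact h1.add h2

/-- **The damped block matrix is Hurwitz.**  If `U_I − U_LN` is Hurwitz then so is
`[[−1 − NU_L, −N − NU_I], [U_L, U_I]]`: with `η = v_L + Nv_I` an eigenpair `(μ, (v_L, v_I))` has
`(μ + 1)η = 0`; either `μ = −1`, or `η = 0` and then `(U_I − U_LN)v_I = μv_I` with `v_I ≠ 0`. [folklore] -/
private theorem isHurwitz_fromBlocks_damped {N : Matrix (Fin n) (Fin m) ℝ}
    {UL : Matrix (Fin m) (Fin n) ℝ} {UI : Matrix (Fin m) (Fin m) ℝ} (hA : IsHurwitz (UI - UL * N)) :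
    IsHurwitz (Matrix.fromBlocks (-1 - N * UL) (-N - N * UI) UL UI) := by
  intro μ v hv hJv
  set f : ℝ →+* ℂ := algebraMap ℝ ℂ with hf
  set Nc : Matrix (Fin n) (Fin m) ℂ := N.map f with hNc
  set ULc : Matrix (Fin m) (Fin n) ℂ := UL.map f with hULc
  set UIc : Matrix (Fin m) (Fin m) ℂ := UI.map f with hUIc
  have hmap : (Matrix.fromBlocks (-1 - N * UL) (-N - N * UI) UL UI).map f
      = Matrix.fromBlocks (-1 - Nc * ULc) (-Nc - Nc * UIc) ULc UIc := by
    rw [Matrix.fromBlocks_map]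
    congr 1
    · rw [Matrix.map_sub f (map_sub f), Matrix.map_neg f (map_neg f),
        Matrix.map_one f (map_zero f) (map_one f), Matrix.map_mul]
    · rw [Matrix.map_sub f (map_sub f), Matrix.map_neg f (map_neg f), Matrix.map_mul]
  set vL : Fin n → ℂ := fun l => v (Sum.inl l) with hvL
  set vI : Fin m → ℂ := fun i => v (Sum.inr i) with hvI
  have hvsplit : v = Sum.elim vL vI := by
    funext k; cases k <;> rfl
  rw [hmap, hvsplit, Matrix.fromBlocks_mulVec] at hJv
  have h1 : ∀ l, (-(vL l) - (Nc *ᵥ (ULc *ᵥ vL)) l) + (-(Nc *ᵥ vI) l - (Nc *ᵥ (UIc *ᵥ vI)) l)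
      = μ * vL l := by
    intro l
    have := congrFun hJv (Sum.inl l)
    simp only [Sum.elim_inl, Sum.elim_comp_inl, Sum.elim_comp_inr, Pi.add_apply, Pi.smul_apply,
      smul_eq_mul, sub_mulVec, neg_mulVec, one_mulVec, Pi.sub_apply, Pi.neg_apply,
      ← mulVec_mulVec] at this
    exact this
  have h2 : ∀ i, (ULc *ᵥ vL) i + (UIc *ᵥ vI) i = μ * vI i := by
    intro i
    have := congrFun hJv (Sum.inr i)
    simpa only [Sum.elim_inr, Sum.elim_comp_inl, Sum.elim_comp_inr, Pi.add_apply, Pi.smul_apply,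
      smul_eq_mul] using this
  have h2N : ∀ l, (Nc *ᵥ (ULc *ᵥ vL)) l + (Nc *ᵥ (UIc *ᵥ vI)) l = μ * (Nc *ᵥ vI) l := by
    intro l
    have hvec : ULc *ᵥ vL + UIc *ᵥ vI = μ • vI := by
      funext i
      rw [Pi.add_apply, Pi.smul_apply, smul_eq_mul]
      exact h2 i
    have := congrArg (fun w => (Nc *ᵥ w) l) hvec
    simp only [mulVec_add, mulVec_smul, Pi.add_apply, Pi.smul_apply, smul_eq_mul] at this
    exact this
  set η : Fin n → ℂ := fun l => vL l + (Nc *ᵥ vI) l with hη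
  have hηeq : ∀ l, (μ + 1) * η l = 0 := by
    intro l
    have e1 := h1 l
    have e2 := h2N l
    simp only [hη]
    linear_combination -e1 - e2
  by_cases hη0 : η = 0
  · have hvLeq : vL = -(Nc *ᵥ vI) := by
      funext l
      have := congrFun hη0 l
      simp only [hη, Pi.zero_apply] at this
      rw [Pi.neg_apply]
      linear_combination this
    have hvI : vI ≠ 0 := by
      intro hvI0
      apply hv
      rw [hvsplit, hvLeq, hvI0, mulVec_zero, neg_zero]
      funext k; cases k <;> rfl
    have hred : ((UI - UL * N).map f) *ᵥ vI = μ • vI := by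
      rw [Matrix.map_sub f (map_sub f), Matrix.map_mul, sub_mulVec, ← mulVec_mulVec]
      funext i
      have := h2 i
      rw [hvLeq, mulVec_neg] at this
      simp only [Pi.sub_apply, Pi.neg_apply, Pi.smul_apply, smul_eq_mul] at this ⊢
      linear_combination this
    exact hA μ vI hvI hred
  · obtain ⟨l, hl⟩ : ∃ l, η l ≠ 0 := Function.ne_iff.mp hη0
    have h3 : μ + 1 = 0 := (mul_eq_zero.1 (hηeq l)).resolve_right hl
    have hμ : μ = -1 := by linear_combination h3
    rw [hμ]
    norm_num

/-! ### The underlying (damped) field and its linearisation -/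

variable (W)

/-- The load derivatives along a state, `dQ_l = Q_l'(E_l)`, for a choice `dQf l` of the derivative
function of each load model. [cite: SimpsonporcoDorflerBullo2017, proof of Theorem 3.2, eq. (3.11′) (`D_ii = dQ_i(E_i)/dE_i`)] -/
def dQState (dQf : Fin n → ℝ → ℝ) (E : Fin n ⊕ Fin m → ℝ) : Fin n → ℝ := fun l => dQf l (E (Sum.inl l))

/-- The inverter velocities `Ė_I = τ_I⁻¹ × (inverter rows of (3.3))`.
[cite: SimpsonporcoDorflerBullo2017, §3.1 eq. (3.3)] -/
def invVel (QL : Fin n → ℝ → ℝ) (E : Fin n ⊕ Fin m → ℝ) : Fin m → ℝ :=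
  fun i => W.closedLoop QL E (Sum.inr i) / W.τ i

/-- The load residuals (the algebraic rows of (3.3)). [cite: SimpsonporcoDorflerBullo2017, §3.1 eq. (3.3)] -/
def loadRes (QL : Fin n → ℝ → ℝ) (E : Fin n ⊕ Fin m → ℝ) : Fin n → ℝ :=
  fun l => W.closedLoop QL E (Sum.inl l)

/-- **The underlying vector field of the index-one DAE (3.3), with constraint damping.**  On the
dynamic variables it is `Ė_I = τ_I⁻¹f_I(E)`; on the algebraic variables it is Riaza's
`−J_LL⁻¹J_LI Ė_I` (differentiate `0 = f_L(E)` once) plus a term `−C f_L(E)` that VANISHES on the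
constraint set `{f_L = 0}` where the DAE solutions live (`C` a fixed matrix; below `C = J_LL(E*)⁻¹`,
which makes the linearisation Hurwitz transversally to the constraint set as well).
[cite: Riaza2008, §3.1 eqs. (3.2)–(3.3) («`z' = −g_z⁻¹(y,z)g_y(y,z)h(y,z)` … for which `g(y,z) = 0` is an invariant comprising the solutions of the original DAE»); SimpsonporcoDorflerBullo2017, proof of Theorem 3.2 ([RR:04])] -/
def dampedField (QL dQf : Fin n → ℝ → ℝ) (C : Matrix (Fin n) (Fin n) ℝ) (E : Fin n ⊕ Fin m → ℝ) :
    Fin n ⊕ Fin m → ℝ :=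
  Sum.elim
    (-((W.jacLL (dQState dQf E) E)⁻¹ *ᵥ (W.jacLI (dQState dQf E) E *ᵥ W.invVel QL E))
      - C *ᵥ W.loadRes QL E)
    (W.invVel QL E)

/-- The linearisation of `dampedField` at an equilibrium, in blocks (`L` = loads, `I` = inverters):
`[[−CJ_LL − J_LL⁻¹J_LI τ⁻¹J_IL, −CJ_LI − J_LL⁻¹J_LI τ⁻¹J_II], [τ⁻¹J_IL, τ⁻¹J_II]]`.
[cite: Riaza2008, §3.1 eq. (3.3); SimpsonporcoDorflerBullo2017, proof of Theorem 3.2] -/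
def dampedJac (dQ : Fin n → ℝ) (C : Matrix (Fin n) (Fin n) ℝ) (E : Fin n ⊕ Fin m → ℝ) :
    Matrix (Fin n ⊕ Fin m) (Fin n ⊕ Fin m) ℝ :=
  Matrix.fromBlocks
    (-(C * W.jacLL dQ E)
      - (W.jacLL dQ E)⁻¹ * W.jacLI dQ E * (diagonal (fun i => (W.τ i)⁻¹) * W.jacIL dQ E))
    (-(C * W.jacLI dQ E)
      - (W.jacLL dQ E)⁻¹ * W.jacLI dQ E * (diagonal (fun i => (W.τ i)⁻¹) * W.jacII dQ E))
    (diagonal (fun i => (W.τ i)⁻¹) * W.jacIL dQ E)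
    (diagonal (fun i => (W.τ i)⁻¹) * W.jacII dQ E)

/-- `J` as the block matrix of its blocks. [folklore] -/
private theorem jac_eq_fromBlocks (dQ : Fin n → ℝ) (E : Fin n ⊕ Fin m → ℝ) :
    W.jac dQ E = Matrix.fromBlocks (W.jacLL dQ E) (W.jacLI dQ E) (W.jacIL dQ E) (W.jacII dQ E) :=
  (Matrix.fromBlocks_toBlocks _).symm

/-- Rows of `Jh` in blocks. [folklore] -/
private theorem jac_mulVec_sumElim (dQ : Fin n → ℝ) (E : Fin n ⊕ Fin m → ℝ) (hL : Fin n → ℝ)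
    (hI : Fin m → ℝ) :
    W.jac dQ E *ᵥ Sum.elim hL hI
      = Sum.elim (W.jacLL dQ E *ᵥ hL + W.jacLI dQ E *ᵥ hI)
          (W.jacIL dQ E *ᵥ hL + W.jacII dQ E *ᵥ hI) := by
  rw [jac_eq_fromBlocks, Matrix.fromBlocks_mulVec, Sum.elim_comp_inl, Sum.elim_comp_inr]

/-- The `LI` block of `J` does not involve the loads' derivatives: `(J_LI)_li = E_lB_li`.
[cite: SimpsonporcoDorflerBullo2017, proof of Theorem 3.2, eq. (3.11′)] -/
theorem jacLI_apply (dQ : Fin n → ℝ) (E : Fin n ⊕ Fin m → ℝ) (l : Fin n) (i : Fin m) :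
    W.jacLI dQ E l i = E (Sum.inl l) * W.B (Sum.inl l) (Sum.inr i) := by
  rw [jacLI, Matrix.toBlocks₁₂, of_apply, jac, Matrix.add_apply, Matrix.add_apply, diagonal_mul,
    diagonal_apply_ne _ (by simp), diagonal_apply_ne _ (by simp), add_zero, add_zero]

/-- Entries of the `LL` block: `(J_LL)_ll' = E_lB_ll' + δ_ll'((BE)_l + dQ_l)`.
[cite: SimpsonporcoDorflerBullo2017, proof of Theorem 3.2, eq. (3.11′)] -/
theorem jacLL_apply (dQ : Fin n → ℝ) (E : Fin n ⊕ Fin m → ℝ) (l l' : Fin n) :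
    W.jacLL dQ E l l' = E (Sum.inl l) * W.B (Sum.inl l) (Sum.inl l')
      + if l = l' then (W.B *ᵥ E) (Sum.inl l) + dQ l else 0 := by
  rw [jacLL, Matrix.toBlocks₁₁, of_apply, jac, Matrix.add_apply, Matrix.add_apply, diagonal_mul,
    diagonal_apply, diagonal_apply]
  by_cases h : l = l'
  · subst h
    simp only [if_true, jacDiag, Sum.elim_inl]
    ring
  · rw [if_neg (fun hh => h (Sum.inl_injective hh)), if_neg (fun hh => h (Sum.inl_injective hh)),
      if_neg h]
    ring

variable {W}

/-- `E ↦ J_LL(E)` (with `dQ_l = dQf_l(E_l)`) is continuous at `E₀` when each `dQf_l` is continuous at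
`E₀,l`. [folklore] -/
private theorem continuousAt_jacLL {dQf : Fin n → ℝ → ℝ} {E₀ : Fin n ⊕ Fin m → ℝ}
    (hcont : ∀ l, ContinuousAt (dQf l) (E₀ (Sum.inl l))) :
    ContinuousAt (fun E => W.jacLL (dQState dQf E) E) E₀ := by
  refine continuousAt_pi.2 fun l => continuousAt_pi.2 fun l' => ?_
  simp only [jacLL_apply, dQState]
  refine (((continuous_apply (Sum.inl l)).continuousAt).mul continuousAt_const).add ?_
  by_cases h : l = l'
  · simp only [h, if_true]
    refine (W.hasFDerivAt_Brow (Sum.inl l') E₀).continuousAt.add ?_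
    have h1 : ContinuousAt (fun E : Fin n ⊕ Fin m → ℝ => E (Sum.inl l')) E₀ :=
      (continuous_apply (Sum.inl l')).continuousAt
    subst h
    exact ContinuousAt.comp (hcont l) h1
  · simp only [h, if_false]
    exact continuousAt_const

/-- … and so is `E ↦ J_LL(E)⁻¹` where `J_LL(E₀)` is invertible. [folklore] -/
private theorem continuousAt_jacLL_inv {dQf : Fin n → ℝ → ℝ} {E₀ : Fin n ⊕ Fin m → ℝ}
    (hcont : ∀ l, ContinuousAt (dQf l) (E₀ (Sum.inl l)))
    (hdet : (W.jacLL (dQState dQf E₀) E₀).det ≠ 0) :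
    ContinuousAt (fun E => (W.jacLL (dQState dQf E) E)⁻¹) E₀ := by
  have h1 := continuousAt_jacLL (W := W) hcont
  have h2 : ContinuousAt Inv.inv (W.jacLL (dQState dQf E₀) E₀) := by
    refine continuousAt_matrix_inv _ ?_
    rw [Ring.inverse_eq_inv']
    exact continuousAt_inv₀ hdet
  exact ContinuousAt.comp (f := fun E => W.jacLL (dQState dQf E) E) (g := Inv.inv) h2 h1

/-- The `L` rows of the linearisation applied to a vector. [folklore] -/
private theorem dampedJac_mulVec_inl (dQ : Fin n → ℝ) (C : Matrix (Fin n) (Fin n) ℝ)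
    (E h : Fin n ⊕ Fin m → ℝ) (l : Fin n) :
    (W.dampedJac dQ C E *ᵥ h) (Sum.inl l)
      = -(((W.jacLL dQ E)⁻¹ *ᵥ (W.jacLI dQ E *ᵥ
            fun i => (W.τ i)⁻¹ * (W.jac dQ E *ᵥ h) (Sum.inr i))) l)
        - (C *ᵥ fun l' => (W.jac dQ E *ᵥ h) (Sum.inl l')) l := by
  have hsplit : h = Sum.elim (fun l => h (Sum.inl l)) (fun i => h (Sum.inr i)) := by
    funext k; cases k <;> rfl
  set hL : Fin n → ℝ := fun l => h (Sum.inl l)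
  set hI : Fin m → ℝ := fun i => h (Sum.inr i)
  rw [hsplit, jac_mulVec_sumElim, dampedJac, Matrix.fromBlocks_mulVec, Sum.elim_inl]
  simp only [Sum.elim_inl, Sum.elim_inr, Sum.elim_comp_inl, Sum.elim_comp_inr]
  have hd : (fun i => (W.τ i)⁻¹ * (W.jacIL dQ E *ᵥ hL + W.jacII dQ E *ᵥ hI) i)
      = diagonal (fun i => (W.τ i)⁻¹) *ᵥ (W.jacIL dQ E *ᵥ hL + W.jacII dQ E *ᵥ hI) := by
    funext i; rw [mulVec_diagonal]
  have hw : (fun l' => (W.jacLL dQ E *ᵥ hL + W.jacLI dQ E *ᵥ hI) l')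
      = W.jacLL dQ E *ᵥ hL + W.jacLI dQ E *ᵥ hI := rfl
  rw [hd, hw]
  simp only [sub_mulVec, neg_mulVec, mulVec_add, ← mulVec_mulVec, Pi.add_apply, Pi.sub_apply,
    Pi.neg_apply]
  ring

/-- The `I` rows of the linearisation applied to a vector. [folklore] -/
private theorem dampedJac_mulVec_inr (dQ : Fin n → ℝ) (C : Matrix (Fin n) (Fin n) ℝ)
    (E h : Fin n ⊕ Fin m → ℝ) (i : Fin m) :
    (W.dampedJac dQ C E *ᵥ h) (Sum.inr i) = (W.τ i)⁻¹ * (W.jac dQ E *ᵥ h) (Sum.inr i) := by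
  have hsplit : h = Sum.elim (fun l => h (Sum.inl l)) (fun i => h (Sum.inr i)) := by
    funext k; cases k <;> rfl
  rw [hsplit, jac_mulVec_sumElim, dampedJac, Matrix.fromBlocks_mulVec, Sum.elim_inr, Sum.elim_inr]
  simp only [Sum.elim_comp_inl, Sum.elim_comp_inr, Pi.add_apply, ← mulVec_mulVec, mulVec_diagonal]
  ring

/-- With `C = J_LL⁻¹` the linearisation is the damped block matrix of
`isHurwitz_fromBlocks_damped` with `N = J_LL⁻¹J_LI`, `U = τ⁻¹[J_IL J_II]`, and
`U_I − U_LN = τ⁻¹(J_II − J_ILJ_LL⁻¹J_LI)` is the reduced matrix. [folklore] -/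
private theorem isHurwitz_dampedJac {dQ : Fin n → ℝ} {E : Fin n ⊕ Fin m → ℝ}
    (hdet : IsUnit (W.jacLL dQ E).det) (hred : IsHurwitz (W.redStateMatrix dQ E)) :
    IsHurwitz (W.dampedJac dQ (W.jacLL dQ E)⁻¹ E) := by
  have hform : W.dampedJac dQ (W.jacLL dQ E)⁻¹ E
      = Matrix.fromBlocks
          (-1 - (W.jacLL dQ E)⁻¹ * W.jacLI dQ E * (diagonal (fun i => (W.τ i)⁻¹) * W.jacIL dQ E))
          (-((W.jacLL dQ E)⁻¹ * W.jacLI dQ E)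
            - (W.jacLL dQ E)⁻¹ * W.jacLI dQ E * (diagonal (fun i => (W.τ i)⁻¹) * W.jacII dQ E))
          (diagonal (fun i => (W.τ i)⁻¹) * W.jacIL dQ E)
          (diagonal (fun i => (W.τ i)⁻¹) * W.jacII dQ E) := by
    rw [dampedJac, nonsing_inv_mul _ hdet]
  rw [hform]
  refine isHurwitz_fromBlocks_damped ?_
  have hA : diagonal (fun i => (W.τ i)⁻¹) * W.jacII dQ E
        - diagonal (fun i => (W.τ i)⁻¹) * W.jacIL dQ E * ((W.jacLL dQ E)⁻¹ * W.jacLI dQ E)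
      = W.redStateMatrix dQ E := by
    simp only [redStateMatrix, Matrix.mul_sub, Matrix.mul_assoc]
  rw [hA]
  exact hred

/-- The field vanishes at an equilibrium of (3.3). [folklore] -/
private theorem dampedField_eq_zero {QL dQf : Fin n → ℝ → ℝ} {C : Matrix (Fin n) (Fin n) ℝ}
    {E₀ : Fin n ⊕ Fin m → ℝ} (heq : W.IsEquilibrium QL E₀) : W.dampedField QL dQf C E₀ = 0 := by
  have h0 : ∀ k, W.closedLoop QL E₀ k = 0 := fun k => congrFun heq k
  have hu : W.invVel QL E₀ = 0 := by
    funext i; simp [invVel, h0]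
  have hr : W.loadRes QL E₀ = 0 := by
    funext l; simp [loadRes, h0]
  rw [dampedField, hu, hr]
  simp only [mulVec_zero, neg_zero, sub_zero]
  funext k; cases k <;> rfl

/-- **The linearisation of the damped underlying field at an equilibrium** `E₀` of (3.3): if each
`Q_l` has derivative `dQf_l` AT `E₀,l`, each `dQf_l` is continuous there, and `J_LL(E₀)` is
invertible, then `dampedField` has Fréchet derivative `dampedJac` at `E₀` (product rule at a zero:
the factor `J_LL(E)⁻¹J_LI(E)` is only continuous, but it multiplies `Ė_I`, which vanishes at `E₀`).
[cite: Riaza2008, §3.1 (the vector field (3.3) is `C^{k−1}`); SimpsonporcoDorflerBullo2017, proof of Theorem 3.2] -/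
theorem hasFDerivAt_dampedField {QL dQf : Fin n → ℝ → ℝ} {C : Matrix (Fin n) (Fin n) ℝ}
    {E₀ : Fin n ⊕ Fin m → ℝ} (heq : W.IsEquilibrium QL E₀)
    (hQ : ∀ l, HasDerivAt (QL l) (dQf l (E₀ (Sum.inl l))) (E₀ (Sum.inl l)))
    (hcont : ∀ l, ContinuousAt (dQf l) (E₀ (Sum.inl l)))
    (hdet : (W.jacLL (dQState dQf E₀) E₀).det ≠ 0) :
    HasFDerivAt (W.dampedField QL dQf C)
      (LinearMap.toContinuousLinearMap (Matrix.toLin' (W.dampedJac (dQState dQf E₀) C E₀))) E₀ := by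
  set dQ₀ : Fin n → ℝ := dQState dQf E₀ with hdQ₀
  set L₀ : (Fin n ⊕ Fin m → ℝ) →L[ℝ] (Fin n ⊕ Fin m → ℝ) :=
    LinearMap.toContinuousLinearMap (Matrix.toLin' (W.jac dQ₀ E₀)) with hL₀
  have hL₀apply : ∀ h, L₀ h = W.jac dQ₀ E₀ *ᵥ h := fun h => by
    simp [hL₀, Matrix.toLin'_apply]
  have hcl : HasFDerivAt (W.closedLoop QL) L₀ E₀ := hasFDerivAt_closedLoop fun l => hQ l
  have hclk : ∀ k, HasFDerivAt (fun E => W.closedLoop QL E k)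
      ((ContinuousLinearMap.proj k : (Fin n ⊕ Fin m → ℝ) →L[ℝ] ℝ).comp L₀) E₀ :=
    fun k => hasFDerivAt_pi'.1 hcl k
  have h0 : ∀ k, W.closedLoop QL E₀ k = 0 := fun k => congrFun heq k
  -- the inverter velocities
  have hu : ∀ i, HasFDerivAt (fun E => W.invVel QL E i)
      ((W.τ i)⁻¹ • (ContinuousLinearMap.proj (Sum.inr i) : (Fin n ⊕ Fin m → ℝ) →L[ℝ] ℝ).comp L₀)
        E₀ := by
    intro i
    have := (hclk (Sum.inr i)).const_mul (W.τ i)⁻¹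
    refine this.congr_of_eventuallyEq (Eventually.of_forall fun E => ?_)
    simp only [invVel, div_eq_inv_mul]
  have hu0 : ∀ i, W.invVel QL E₀ i = 0 := fun i => by simp [invVel, h0]
  -- `ψ_k(E) = (J_LI(E) Ė_I(E))_k`, vanishing at `E₀`
  have hψ : ∀ k, HasFDerivAt (fun E => (W.jacLI (dQState dQf E) E *ᵥ W.invVel QL E) k)
      (∑ i, (fun E : Fin n ⊕ Fin m → ℝ => W.jacLI (dQState dQf E) E k i) E₀ •
        ((W.τ i)⁻¹ • (ContinuousLinearMap.proj (Sum.inr i) : (Fin n ⊕ Fin m → ℝ) →L[ℝ] ℝ).comp L₀))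
        E₀ := by
    intro k
    have hfun : (fun E => (W.jacLI (dQState dQf E) E *ᵥ W.invVel QL E) k)
        = fun E => ∑ i, W.jacLI (dQState dQf E) E k i * W.invVel QL E i := by
      funext E; rfl
    rw [hfun]
    refine HasFDerivAt.fun_sum fun i _ => ?_
    refine hasFDerivAt_mul_of_continuousAt_of_eq_zero ?_ (hu i) (hu0 i)
    have hentry : (fun E : Fin n ⊕ Fin m → ℝ => W.jacLI (dQState dQf E) E k i)
        = fun E => E (Sum.inl k) * W.B (Sum.inl k) (Sum.inr i) := by
      funext E; rw [jacLI_apply]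
    rw [hentry]
    exact ((continuous_apply (Sum.inl k)).continuousAt).mul continuousAt_const
  have hψ0 : ∀ k, (W.jacLI (dQState dQf E₀) E₀ *ᵥ W.invVel QL E₀) k = 0 := by
    intro k
    have : W.invVel QL E₀ = 0 := funext hu0
    rw [this, mulVec_zero, Pi.zero_apply]
  -- the `J_LL⁻¹` factor is continuous
  have hΦ : ∀ l k, ContinuousAt (fun E => (W.jacLL (dQState dQf E) E)⁻¹ l k) E₀ := by
    intro l k
    have hc := continuousAt_jacLL_inv (W := W) hcont hdet
    exact (((continuous_apply k).comp (continuous_apply l)).continuousAt).comp hc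
  have hA : ∀ l, HasFDerivAt
      (fun E => ((W.jacLL (dQState dQf E) E)⁻¹ *ᵥ (W.jacLI (dQState dQf E) E *ᵥ W.invVel QL E)) l)
      (∑ k, (fun E : Fin n ⊕ Fin m → ℝ => (W.jacLL (dQState dQf E) E)⁻¹ l k) E₀ •
        ∑ i, (fun E : Fin n ⊕ Fin m → ℝ => W.jacLI (dQState dQf E) E k i) E₀ •
          ((W.τ i)⁻¹ • (ContinuousLinearMap.proj (Sum.inr i) : (Fin n ⊕ Fin m → ℝ) →L[ℝ] ℝ).comp L₀))
      E₀ := by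
    intro l
    have hfun : (fun E => ((W.jacLL (dQState dQf E) E)⁻¹ *ᵥ
          (W.jacLI (dQState dQf E) E *ᵥ W.invVel QL E)) l)
        = fun E => ∑ k, (W.jacLL (dQState dQf E) E)⁻¹ l k *
            (W.jacLI (dQState dQf E) E *ᵥ W.invVel QL E) k := by
      funext E; rfl
    rw [hfun]
    exact HasFDerivAt.fun_sum fun k _ =>
      hasFDerivAt_mul_of_continuousAt_of_eq_zero (hΦ l k) (hψ k) (hψ0 k)
  -- the damping term
  have hC : ∀ l, HasFDerivAt (fun E => (C *ᵥ W.loadRes QL E) l)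
      (∑ l', C l l' • (ContinuousLinearMap.proj (Sum.inl l') : (Fin n ⊕ Fin m → ℝ) →L[ℝ] ℝ).comp L₀)
      E₀ := by
    intro l
    have hfun : (fun E => (C *ᵥ W.loadRes QL E) l) = fun E => ∑ l', C l l' * W.closedLoop QL E (Sum.inl l') := by
      funext E; rfl
    rw [hfun]
    exact HasFDerivAt.fun_sum fun l' _ => (hclk (Sum.inl l')).const_mul (C l l')
  -- assemble
  rw [hasFDerivAt_pi']
  intro kk
  cases kk with
  | inl l =>
    have hcomp := ((hA l).neg).sub (hC l)
    refine (hcomp.congr_of_eventuallyEq (Eventually.of_forall fun E => ?_)).congr_fderiv ?_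
    · simp only [dampedField, Sum.elim_inl, Pi.sub_apply, Pi.neg_apply]
    · ext h
      rw [ContinuousLinearMap.comp_apply, ContinuousLinearMap.proj_apply,
        LinearMap.coe_toContinuousLinearMap', Matrix.toLin'_apply, dampedJac_mulVec_inl]
      simp only [_root_.sub_apply, _root_.neg_apply, _root_.sum_apply, _root_.smul_apply,
        ContinuousLinearMap.comp_apply, ContinuousLinearMap.proj_apply, smul_eq_mul, hL₀apply]
      rfl
  | inr i =>
    refine ((hu i).congr_of_eventuallyEq (Eventually.of_forall fun E => ?_)).congr_fderiv ?_
    · simp only [dampedField, Sum.elim_inr]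
    · ext h
      rw [ContinuousLinearMap.comp_apply, ContinuousLinearMap.proj_apply,
        LinearMap.coe_toContinuousLinearMap', Matrix.toLin'_apply, dampedJac_mulVec_inr,
        _root_.smul_apply, ContinuousLinearMap.comp_apply, ContinuousLinearMap.proj_apply,
        smul_eq_mul, hL₀apply]


variable (W) in
/-- **C¹ solutions of the differential-algebraic closed loop (3.3) on `[0, T]`**: a curve `E` with a
derivative `E'(t)` (within `[0, T]`) at every `t ∈ [0, T]`, whose load rows of (3.3) vanish and whose
inverter components obey `τ_iĖ_i = ` inverter row `i` of (3.3).  (Riaza's solution notion: `C¹`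
curves satisfying the DAE; consistent initial conditions are built in.)
[cite: SimpsonporcoDorflerBullo2017, §3.1 eq. (3.3); Riaza2008, §3.1 («consistent initial conditions»)] -/
def IsDAESolutionOn (QL : Fin n → ℝ → ℝ) (E : ℝ → Fin n ⊕ Fin m → ℝ) (T : ℝ) : Prop :=
  ∃ E' : ℝ → Fin n ⊕ Fin m → ℝ, ∀ t ∈ Icc (0 : ℝ) T,
    HasDerivWithinAt E (E' t) (Icc (0 : ℝ) T) t ∧ (∀ l, W.closedLoop QL (E t) (Sum.inl l) = 0) ∧
      ∀ i, E' t (Sum.inr i) = W.closedLoop QL (E t) (Sum.inr i) / W.τ i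

/-- **DAE solutions solve the underlying ODE** («`g(y,z) = 0` is an invariant comprising the solutions
of the original DAE»): along a C¹ solution of (3.3) on `[0, T]` (`T > 0`), at a time where the loads
are differentiable with derivatives `dQf_l(E_l)` and `J_LL` is invertible, differentiating the load rows
gives `Ė_L = −J_LL⁻¹J_LIĖ_I`, so `Ė = dampedField(E)` (the damping term vanishes on solutions).
[cite: Riaza2008, §3.1 eqs. (3.1)–(3.2) («one differentiation in (3.1b) suffices to obtain … `z' = −g_z⁻¹g_yh`»); SimpsonporcoDorflerBullo2017, proof of Theorem 3.2] -/
theorem hasDerivWithinAt_dampedField {QL dQf : Fin n → ℝ → ℝ} (C : Matrix (Fin n) (Fin n) ℝ)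
    {E E' : ℝ → Fin n ⊕ Fin m → ℝ} {T t : ℝ} (hT : 0 < T) (ht : t ∈ Icc (0 : ℝ) T)
    (hE : HasDerivWithinAt E (E' t) (Icc (0 : ℝ) T) t)
    (hload : ∀ s ∈ Icc (0 : ℝ) T, ∀ l, W.closedLoop QL (E s) (Sum.inl l) = 0)
    (hinv : ∀ i, E' t (Sum.inr i) = W.closedLoop QL (E t) (Sum.inr i) / W.τ i)
    (hQ : ∀ l, HasDerivAt (QL l) (dQf l (E t (Sum.inl l))) (E t (Sum.inl l)))
    (hdet : IsUnit (W.jacLL (dQState dQf (E t)) (E t)).det) :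
    HasDerivWithinAt E (W.dampedField QL dQf C (E t)) (Icc (0 : ℝ) T) t := by
  set dQ : Fin n → ℝ := dQState dQf (E t) with hdQ
  -- chain rule along the solution
  have hcl : HasFDerivAt (W.closedLoop QL)
      (LinearMap.toContinuousLinearMap (Matrix.toLin' (W.jac dQ (E t)))) (E t) :=
    hasFDerivAt_closedLoop fun l => hQ l
  have hcomp := hcl.comp_hasDerivWithinAt t hE
  have hcomp' : HasDerivWithinAt (fun s => W.closedLoop QL (E s)) (W.jac dQ (E t) *ᵥ E' t)
      (Icc (0 : ℝ) T) t := by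
    have h1 : (LinearMap.toContinuousLinearMap (Matrix.toLin' (W.jac dQ (E t)))) (E' t)
        = W.jac dQ (E t) *ᵥ E' t := by simp [Matrix.toLin'_apply]
    rw [← h1]
    exact hcomp
  -- the load rows are identically zero, so their derivative vanishes
  have hrow : ∀ l, (W.jac dQ (E t) *ᵥ E' t) (Sum.inl l) = 0 := by
    intro l
    have hl : HasDerivWithinAt (fun s => W.closedLoop QL (E s) (Sum.inl l))
        ((W.jac dQ (E t) *ᵥ E' t) (Sum.inl l)) (Icc (0 : ℝ) T) t := hasDerivWithinAt_pi.1 hcomp' _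
    have hz : HasDerivWithinAt (fun s => W.closedLoop QL (E s) (Sum.inl l)) (0 : ℝ)
        (Icc (0 : ℝ) T) t :=
      (hasDerivWithinAt_const t (Icc (0 : ℝ) T) (0 : ℝ)).congr_of_mem
        (fun s hs => hload s hs l) ht
    exact (uniqueDiffOn_Icc hT t ht).eq_deriv _ hl hz
  -- solve the differentiated constraint for `Ė_L`
  set vL : Fin n → ℝ := fun l => E' t (Sum.inl l) with hvL
  set vI : Fin m → ℝ := fun i => E' t (Sum.inr i) with hvI
  have hsplit : E' t = Sum.elim vL vI := by
    funext k; cases k <;> rfl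
  have hlin : W.jacLL dQ (E t) *ᵥ vL + W.jacLI dQ (E t) *ᵥ vI = 0 := by
    funext l
    have := hrow l
    rw [hsplit, jac_mulVec_sumElim, Sum.elim_inl] at this
    exact this
  have hvLeq : vL = -((W.jacLL dQ (E t))⁻¹ *ᵥ (W.jacLI dQ (E t) *ᵥ vI)) := by
    have h1 : W.jacLL dQ (E t) *ᵥ vL = -(W.jacLI dQ (E t) *ᵥ vI) := eq_neg_of_add_eq_zero_left hlin
    calc vL = ((W.jacLL dQ (E t))⁻¹ * W.jacLL dQ (E t)) *ᵥ vL := by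
          rw [nonsing_inv_mul _ hdet, one_mulVec]
      _ = -((W.jacLL dQ (E t))⁻¹ *ᵥ (W.jacLI dQ (E t) *ᵥ vI)) := by
          rw [← mulVec_mulVec, h1, mulVec_neg]
  have hvIeq : vI = W.invVel QL (E t) := by
    funext i; rw [hvI, invVel]; exact hinv i
  have hres : W.loadRes QL (E t) = 0 := by
    funext l; exact hload t ht l
  have hfield : E' t = W.dampedField QL dQf C (E t) := by
    rw [hsplit, dampedField, hres, mulVec_zero, sub_zero, hvLeq, hvIeq]
  rw [← hfield]
  exact hE

/-- **Theorem 3.2 (Stability from Reduced Jacobian), the differential-algebraic conclusion: local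
exponential stability of the equilibrium `(E_L, E_I)`.**  Data: `B` symmetric, `−(B_II + K_I) ≻ 0`,
`τ_i > 0`; a solution `E_L ∈ ℝ^n_{>0}` of the reduced power flow equation (3.7) with positive
recovered inverter voltages `E_I = W₂(E_L, E_I*)`; load models `Q_l` that are `C¹` near `E_L,l`
(derivative function `dQf_l`, continuous at `E_L,l`).  If `J_red(E_L)` (with `∂Q_l/∂E_l = dQf_l(E_L,l)`)
is Hurwitz, then there are `ρ, k, λ > 0` such that every C¹ solution of the differential-algebraic
closed loop (3.3) on `[0, T]` starting within `ρ` of `E* = (E_L, E_I)` satisfies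
`‖E(t) − E*‖ ≤ k‖E(0) − E*‖e^{−λt}` on `[0, T]`.  Proof = the print's route: linearise (§1), eliminate
the algebraic equations (index one, §3), reduced matrix Hurwitz (§3); then Riaza's reduction of the
index-one DAE to its underlying ODE on the invariant constraint set (here with a constraint-damping
term so that Lyapunov's indirect method — the tree's Khalil Thm. 4.7 — applies on the whole space),
and a first-exit argument keeping solutions in the region where `J_LL` is invertible.  MODEL: as in
the companion file; SOS/ROA-type quantitative estimates of `ρ` are not part of the statement.
[cite: SimpsonporcoDorflerBullo2017, §3.2 Theorem 3.2 («then the equilibrium point `(E_L, E_I)` of the differential-algebraic system (3.3) is locally exponentially stable») and its proof («We appeal to [RR:04] …»); Riaza2008, §3.1; HornJohnson2013, §7.6 Thm. 7.6.1 (a)] -/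
theorem theorem_3_2_locallyExpStable (hB : W.B.IsSymm) (hII : (-W.BIIK).PosDef)
    (hτ : ∀ i, 0 < W.τ i) {QL dQf : Fin n → ℝ → ℝ} {EL : Fin n → ℝ} (hEL : ∀ l, 0 < EL l)
    (hEI : ∀ i, 0 < W.invVoltage EL i) (hR : W.ReducedPowerFlow QL EL)
    (hQ : ∀ l, ∀ᶠ e in 𝓝 (EL l), HasDerivAt (QL l) (dQf l e) e)
    (hcont : ∀ l, ContinuousAt (dQf l) (EL l))
    (hH : IsHurwitz (W.jacRed (fun l => dQf l (EL l)) EL)) :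
    ∃ ρ > 0, ∃ k > 0, ∃ lam > 0, ∀ (E : ℝ → Fin n ⊕ Fin m → ℝ) (T : ℝ), W.IsDAESolutionOn QL E T →
      ‖E 0 - W.liftState EL‖ < ρ →
        ∀ t ∈ Icc (0 : ℝ) T,
          ‖E t - W.liftState EL‖ ≤ k * ‖E 0 - W.liftState EL‖ * Real.exp (-lam * t) := by
  set E₀ : Fin n ⊕ Fin m → ℝ := W.liftState EL with hE₀
  set dQ₀ : Fin n → ℝ := fun l => dQf l (EL l) with hdQ₀
  have hdQ₀' : dQState dQf E₀ = dQ₀ := by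
    funext l; rfl
  have hU : IsUnit W.BIIK.det := isUnit_BIIK_det_of_posDef hII
  have heq : W.IsEquilibrium QL E₀ := isEquilibrium_of_reducedPowerFlow hU hR
  have hdetU : IsUnit (W.jacLL dQ₀ E₀).det := isUnit_jacLL_det hB hII hEL hEI hH
  have hdet0 : (W.jacLL (dQState dQf E₀) E₀).det ≠ 0 := by
    rw [hdQ₀']; exact hdetU.ne_zero
  set C : Matrix (Fin n) (Fin n) ℝ := (W.jacLL dQ₀ E₀)⁻¹ with hC
  have hQ₀ : ∀ l, HasDerivAt (QL l) (dQf l (E₀ (Sum.inl l))) (E₀ (Sum.inl l)) :=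
    fun l => (hQ l).self_of_nhds
  have hcont₀ : ∀ l, ContinuousAt (dQf l) (E₀ (Sum.inl l)) := fun l => hcont l
  -- linearisation of the damped underlying field at `E₀`, and its Hurwitz property
  have hV : HasFDerivAt (W.dampedField QL dQf C)
      (LinearMap.toContinuousLinearMap (Matrix.toLin' (W.dampedJac dQ₀ C E₀))) E₀ := by
    have := hasFDerivAt_dampedField (C := C) heq hQ₀ hcont₀ hdet0
    rwa [hdQ₀'] at this
  have hV0 : W.dampedField QL dQf C E₀ = 0 := dampedField_eq_zero heq
  have hHur : IsHurwitz (W.dampedJac dQ₀ C E₀) :=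
    isHurwitz_dampedJac hdetU (redStateMatrix_isHurwitz hB hII hτ hEL hEI hH)
  have hHur' : ∀ (μ : ℂ) (v : Fin n ⊕ Fin m → ℂ), v ≠ 0 →
      ((W.dampedJac dQ₀ C E₀).map ((↑) : ℝ → ℂ)) *ᵥ v = μ • v → μ.re < 0 :=
    fun μ v hv h => hHur μ v hv h
  obtain ⟨ρ₀, hρ₀, k, hk, lam, hlam, H⟩ :=
    Literature.Analysis.ODE.exists_expStable_of_matrix_eig_re_neg hV hV0 hHur'
  -- the region where the loads are differentiable and `J_LL` is invertible
  have hgood : ∀ᶠ E in 𝓝 E₀, (∀ l, HasDerivAt (QL l) (dQf l (E (Sum.inl l))) (E (Sum.inl l))) ∧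
      (W.jacLL (dQState dQf E) E).det ≠ 0 := by
    refine (eventually_all.2 fun l => ?_).and ?_
    · have hc : ContinuousAt (fun E : Fin n ⊕ Fin m → ℝ => E (Sum.inl l)) E₀ :=
        (continuous_apply (Sum.inl l)).continuousAt
      exact hc.eventually (hQ l)
    · have hc : ContinuousAt (fun E => (W.jacLL (dQState dQf E) E).det) E₀ :=
        (continuous_id.matrix_det.continuousAt).comp
          (f := fun E => W.jacLL (dQState dQf E) E) (continuousAt_jacLL hcont₀)
      exact hc.eventually_ne hdet0
  obtain ⟨δ, hδ, hδgood⟩ := Metric.eventually_nhds_iff.1 hgood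
  refine ⟨min ρ₀ (δ / (k + 1)), lt_min hρ₀ (div_pos hδ (by linarith)), k, hk, lam, hlam,
    fun E T hsol h0 => ?_⟩
  obtain ⟨E', hE'⟩ := hsol
  have h0ρ : ‖E 0 - E₀‖ < ρ₀ := lt_of_lt_of_le h0 (min_le_left _ _)
  have h0δ' : ‖E 0 - E₀‖ < δ / (k + 1) := lt_of_lt_of_le h0 (min_le_right _ _)
  have hKδ : k * ‖E 0 - E₀‖ < δ := by
    have h1 : k * ‖E 0 - E₀‖ ≤ k * (δ / (k + 1)) := mul_le_mul_of_nonneg_left h0δ'.le hk.le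
    have h2 : k * (δ / (k + 1)) < δ := by
      rw [mul_div_assoc']
      rw [div_lt_iff₀ (by linarith)]
      nlinarith
    linarith
  have h0δ : ‖E 0 - E₀‖ < δ := by
    have : δ / (k + 1) ≤ δ := div_le_self hδ.le (by linarith)
    linarith
  have hcontE : ContinuousOn E (Icc (0 : ℝ) T) := fun t ht => (hE' t ht).1.continuousWithinAt
  -- the ODE holds on every prefix `[0, T']` on which the solution stays `δ`-close to `E₀`
  have hODE : ∀ T', T' ≤ T → (∀ s ∈ Icc (0 : ℝ) T', ‖E s - E₀‖ < δ) →
      ∀ s ∈ Icc (0 : ℝ) T', HasDerivWithinAt E (W.dampedField QL dQf C (E s)) (Icc (0 : ℝ) T') s := by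
    intro T' hT'T hgoodT' s hs
    rcases le_or_gt T' 0 with hT'0 | hT'0
    · exact HasFDerivWithinAt.of_subsingleton (Set.subsingleton_Icc_of_ge hT'0)
    · have hsT : s ∈ Icc (0 : ℝ) T := ⟨hs.1, hs.2.trans hT'T⟩
      have hT0 : 0 < T := hT'0.trans_le hT'T
      have hdist : dist (E s) E₀ < δ := by rw [dist_eq_norm]; exact hgoodT' s hs
      obtain ⟨hQs, hdets⟩ := hδgood hdist
      have := hasDerivWithinAt_dampedField C hT0 hsT (hE' s hsT).1 (fun s' hs' => (hE' s' hs').2.1)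
        (hE' s hsT).2.2 hQs (isUnit_iff_ne_zero.2 hdets)
      exact this.mono (Icc_subset_Icc le_rfl hT'T)
  have hbound : ∀ T', T' ≤ T → (∀ s ∈ Icc (0 : ℝ) T', ‖E s - E₀‖ < δ) →
      ∀ s ∈ Icc (0 : ℝ) T', ‖E s - E₀‖ ≤ k * ‖E 0 - E₀‖ * Real.exp (-lam * s) :=
    fun T' hT'T hg => H E T' (hODE T' hT'T hg) h0ρ
  -- first-exit argument: the solution never leaves the `δ`-ball
  have hall : ∀ s ∈ Icc (0 : ℝ) T, ‖E s - E₀‖ < δ := by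
    by_contra hbad
    simp only [not_forall, not_lt, exists_prop] at hbad
    obtain ⟨s₀, hs₀, hs₀bad⟩ := hbad
    set Bad : Set ℝ := Icc (0 : ℝ) T ∩ (fun s => ‖E s - E₀‖) ⁻¹' Ici δ with hBad
    have hBne : Bad.Nonempty := ⟨s₀, hs₀, hs₀bad⟩
    have hnormcont : ContinuousOn (fun s => ‖E s - E₀‖) (Icc (0 : ℝ) T) :=
      (hcontE.sub continuousOn_const).norm
    have hBclosed : IsClosed Bad :=
      hnormcont.preimage_isClosed_of_isClosed isClosed_Icc isClosed_Ici
    have hBbdd : BddBelow Bad := ⟨0, fun s hs => hs.1.1⟩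
    set t₁ := sInf Bad with ht₁
    have ht₁mem : t₁ ∈ Bad := hBclosed.csInf_mem hBne hBbdd
    have ht₁le : ∀ s ∈ Bad, t₁ ≤ s := fun s hs => csInf_le hBbdd hs
    have ht₁pos : 0 < t₁ := by
      rcases lt_or_eq_of_le ht₁mem.1.1 with h | h
      · exact h
      · exfalso
        have hb : δ ≤ ‖E t₁ - E₀‖ := ht₁mem.2
        rw [← h] at hb
        linarith
    have hbefore : ∀ s ∈ Ico (0 : ℝ) t₁, ‖E s - E₀‖ < δ := by
      intro s hs
      by_contra hge
      have hsBad : s ∈ Bad := ⟨⟨hs.1, hs.2.le.trans ht₁mem.1.2⟩, not_lt.1 hge⟩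
      exact absurd (ht₁le s hsBad) (not_le.2 hs.2)
    have hK : ∀ s ∈ Ico (0 : ℝ) t₁, ‖E s - E₀‖ ≤ k * ‖E 0 - E₀‖ := by
      intro s hs
      have hb := hbound s (hs.2.le.trans ht₁mem.1.2)
        (fun s' hs' => hbefore s' ⟨hs'.1, lt_of_le_of_lt hs'.2 hs.2⟩) s ⟨hs.1, le_rfl⟩
      have hexp : Real.exp (-lam * s) ≤ 1 := by
        rw [Real.exp_le_one_iff]
        nlinarith [hs.1]
      calc ‖E s - E₀‖ ≤ k * ‖E 0 - E₀‖ * Real.exp (-lam * s) := hb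
        _ ≤ k * ‖E 0 - E₀‖ * 1 :=
            mul_le_mul_of_nonneg_left hexp (mul_nonneg hk.le (norm_nonneg _))
        _ = k * ‖E 0 - E₀‖ := mul_one _
    set F : Set ℝ := Icc (0 : ℝ) T ∩ (fun s => ‖E s - E₀‖) ⁻¹' Iic (k * ‖E 0 - E₀‖) with hF
    have hFclosed : IsClosed F :=
      hnormcont.preimage_isClosed_of_isClosed isClosed_Icc isClosed_Iic
    have hsub : Ico (0 : ℝ) t₁ ⊆ F := fun s hs => ⟨⟨hs.1, hs.2.le.trans ht₁mem.1.2⟩, hK s hs⟩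
    have ht₁F : t₁ ∈ F := by
      have hcl : closure (Ico (0 : ℝ) t₁) ⊆ F := hFclosed.closure_subset_iff.2 hsub
      rw [closure_Ico ht₁pos.ne] at hcl
      exact hcl ⟨ht₁pos.le, le_rfl⟩
    have h1 : ‖E t₁ - E₀‖ ≤ k * ‖E 0 - E₀‖ := ht₁F.2
    have h2 : δ ≤ ‖E t₁ - E₀‖ := ht₁mem.2
    linarith
  exact hbound T le_rfl hall

end DAE

/-! ## §7 Theorem 3.3's stability conclusion from network data (append; same sources) -/

section NetworkData

open Filter Set
open scoped Topology

/-- **Theorem 3.3, nonlinear DAE tier** (matrix-level data, as in `theorem_3_3_redStateMatrix_isHurwitz`).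
Under the data hypotheses of Proposition 7.2 (`B` symmetric, off-diagonal entries `≥ 0`, zero row sums,
`−(B + blkdiag(0, K_I)) ≻ 0`, `K_i ≤ 0`, `E_i* > 0`), `τ_i > 0`, and Theorem 3.3's (i)
`−(B_red + [b_shunt])` a nonsingular `M`-matrix (positive definite with the `Z`-sign pattern) and (ii)
`I_shunt > B_redE_L*`: the equilibrium `(E_L^{ZI}, E_I^{ZI})` of the closed loop (3.3) with the ZI loads
`Q_l(E_l) = b_lE_l² + I_lE_l` is locally exponentially stable in the sense of §6 — there are
`ρ, k, λ > 0` such that every C¹ solution of the DAE on `[0, T]` starting within `ρ` of it satisfies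
`‖E(t) − E^{ZI}‖ ≤ k‖E(0) − E^{ZI}‖e^{−λt}` on `[0, T]`.  Proof: companion `theorem_3_3_originalNetwork`
(the positive equilibrium, `J_red(E_L^{ZI})` Hurwitz) and `theorem_3_3_ziLoads` (the reduced power flow
equation), `posDef_neg_BIIK_of_posDef_aug`, and §6 `theorem_3_2_locallyExpStable` with the
everywhere-differentiable load model `Q_l' = 2b_lE_l + I_l`.
[cite: SimpsonporcoDorflerBullo2017, §3.3 Theorem 3.3 («the associated equilibrium point … is locally exponentially stable») with §3.2 Theorem 3.2 and §7 Proposition 7.2; Riaza2008, §3.1] -/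
theorem theorem_3_3_locallyExpStable {bsh Ish : Fin n → ℝ} (hB : W.B.IsSymm)
    (hoff : ∀ k k', k ≠ k' → 0 ≤ W.B k k') (hrowB : ∀ k, ∑ k', W.B k k' = 0)
    (hM : (-(W.B + Matrix.fromBlocks 0 0 0 (diagonal W.K))).PosDef) (hK : ∀ i, W.K i ≤ 0)
    (hE : ∀ i, 0 < W.Estar i) (hτ : ∀ i, 0 < W.τ i) (hA : (-(W.Bred + diagonal bsh)).PosDef)
    (hZ : IsZMatrix (-(W.Bred + diagonal bsh))) (hI : ∀ l, W.redSource l < Ish l) :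
    ∃ ρ > 0, ∃ k > 0, ∃ lam > 0, ∀ (E : ℝ → Fin n ⊕ Fin m → ℝ) (T : ℝ),
      W.IsDAESolutionOn (ziLoad bsh Ish) E T → ‖E 0 - W.ziState bsh Ish‖ < ρ →
        ∀ t ∈ Icc (0 : ℝ) T,
          ‖E t - W.ziState bsh Ish‖ ≤ k * ‖E 0 - W.ziState bsh Ish‖ * Real.exp (-lam * t) := by
  have hII := posDef_neg_BIIK_of_posDef_aug hM
  obtain ⟨-, hpos, -, hHur⟩ := theorem_3_3_originalNetwork hB hoff hrowB hM hK hE hA hZ hI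
  obtain ⟨-, hR, -, -⟩ := theorem_3_3_ziLoads hA hZ hI
  have hEL : ∀ l, 0 < W.ziVoltage bsh Ish l := fun l => hpos (Sum.inl l)
  have hEI : ∀ i, 0 < W.invVoltage (W.ziVoltage bsh Ish) i := fun i => hpos (Sum.inr i)
  set dQf : Fin n → ℝ → ℝ := fun l e => 2 * bsh l * e + Ish l with hdQf
  have hQ : ∀ l, ∀ᶠ e in 𝓝 (W.ziVoltage bsh Ish l), HasDerivAt (ziLoad bsh Ish l) (dQf l e) e :=
    fun l => Filter.Eventually.of_forall fun e => by
      have h1 := ((hasDerivAt_id e).pow 2).const_mul (bsh l)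
      have h2 := (hasDerivAt_id e).const_mul (Ish l)
      refine ((h1.add h2).congr_of_eventuallyEq
        (Filter.Eventually.of_forall fun e' => ?_)).congr_deriv ?_
      · simp [ziLoad]
      · simp [hdQf]
        ring
  have hcont : ∀ l, ContinuousAt (dQf l) (W.ziVoltage bsh Ish l) := fun l =>
    ((continuous_const.mul continuous_id).add continuous_const).continuousAt
  exact theorem_3_2_locallyExpStable hB hII hτ hEL hEI hR hQ hcont hHur

/-- **Theorem 3.3, nonlinear DAE tier, from network data.**  Connected inductive network (`w`
symmetric, `w ≥ 0`, `BranchConnected w`, `B = susceptanceMatrix w`), quadratic droop gains `K_i < 0`,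
voltage set points `E_i* > 0`, time constants `τ_i > 0`, at least one inverter; ZI loads
`Q_l(E_l) = b_lE_l² + I_lE_l` with (i) `−(B_red + [b_shunt])` positive definite (its `Z`-sign pattern
is automatic) and (ii) `I_shunt > B_redE_L*`.  Then the equilibrium `(E_L^{ZI}, E_I^{ZI})` of the
closed loop (3.3) is locally exponentially stable in the sense of §6: there are `ρ, k, λ > 0` such that
every C¹ solution of the DAE on `[0, T]` starting within `ρ` of it satisfies
`‖E(t) − E^{ZI}‖ ≤ k‖E(0) − E^{ZI}‖e^{−λt}`.  All matrix-level hypotheses of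
`theorem_3_3_locallyExpStable` are discharged from the data by the companion's Lemma 7.1
(`susceptanceMatrix_isSymm`, `_offDiag_nonneg`, `sum_susceptanceMatrix_row`,
`posDef_neg_aug_of_branchConnected`, `stieltjes_neg_Bred`).
[cite: SimpsonporcoDorflerBullo2017, §3.3 Theorem 3.3 («the associated equilibrium point … is locally exponentially stable») with §3.2 Theorem 3.2, §7 Lemma 7.1 and Proposition 7.2; Riaza2008, §3.1] -/
theorem theorem_3_3_locallyExpStable_of_network {w : Fin n ⊕ Fin m → Fin n ⊕ Fin m → ℝ}
    {bsh Ish : Fin n → ℝ} (hw : ∀ i j, w i j = w j i) (hw0 : ∀ i j, 0 ≤ w i j)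
    (hconn : BranchConnected w) (hBw : W.B = susceptanceMatrix w) (hK : ∀ i, W.K i < 0)
    (hm : 0 < m) (hE : ∀ i, 0 < W.Estar i) (hτ : ∀ i, 0 < W.τ i)
    (hA : (-(W.Bred + diagonal bsh)).PosDef) (hI : ∀ l, W.redSource l < Ish l) :
    ∃ ρ > 0, ∃ k > 0, ∃ lam > 0, ∀ (E : ℝ → Fin n ⊕ Fin m → ℝ) (T : ℝ),
      W.IsDAESolutionOn (ziLoad bsh Ish) E T → ‖E 0 - W.ziState bsh Ish‖ < ρ →
        ∀ t ∈ Icc (0 : ℝ) T,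
          ‖E t - W.ziState bsh Ish‖ ≤ k * ‖E 0 - W.ziState bsh Ish‖ * Real.exp (-lam * t) := by
  have hB : W.B.IsSymm := by rw [hBw]; exact susceptanceMatrix_isSymm hw
  have hoff : ∀ k k', k ≠ k' → 0 ≤ W.B k k' := fun k k' hkk' => by
    rw [hBw]; exact susceptanceMatrix_offDiag_nonneg hw0 hkk'
  have hrowB : ∀ k, ∑ k', W.B k k' = 0 := fun k => by
    rw [hBw]; exact sum_susceptanceMatrix_row w k
  have hM := posDef_neg_aug_of_branchConnected hw hw0 hconn hBw hK hm
  obtain ⟨-, -, hZ⟩ := stieltjes_neg_Bred hB hoff hM bsh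
  exact theorem_3_3_locallyExpStable hB hoff hrowB hM (fun i => (hK i).le) hE hτ hA hZ hI

end NetworkData

/-! ## §8 Solutions of the DAE (3.3) EXIST from every consistent initial condition near the
equilibrium, and obey the estimate (append): the underlying field is `C¹` on the regular set,
solutions are confined by §6's estimate, global existence (Teschl Cor. 2.15 / Rouche–Habets–Laloy),
and the load constraints are invariant (Grönwall) -/

section DAEExistence

open Filter Set Metric
open scoped Topology

/-! ### Generic helpers (private; the same statements as the private helpers of
`DroopLoadsSolutionExistence.lean`) -/

section MatrixEntries

variable {X : Type*} [NormedAddCommGroup X] [NormedSpace ℝ X] {ι : Type*} [Fintype ι]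
  [DecidableEq ι]

omit W in
/-- The determinant of a matrix of `C¹` functions is `C¹` (Leibniz formula). [folklore] -/
private theorem contDiff_det_of_entries' {A : X → Matrix ι ι ℝ}
    (h : ∀ a b, ContDiff ℝ 1 fun x => A x a b) : ContDiff ℝ 1 fun x => (A x).det := by
  have hform : (fun x => (A x).det)
      = fun x => ∑ σ : Equiv.Perm ι, ((Equiv.Perm.sign σ : ℤ) : ℝ) * ∏ i, A x (σ i) i := by
    funext x; exact Matrix.det_apply' (A x)
  rw [hform]
  refine ContDiff.sum fun σ _ => ?_
  exact contDiff_const.mul (contDiff_prod fun i _ => h (σ i) i)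

omit W in
/-- The adjugate of a matrix of `C¹` functions has `C¹` entries. [folklore] -/
private theorem contDiff_adjugate_of_entries' {A : X → Matrix ι ι ℝ}
    (h : ∀ a b, ContDiff ℝ 1 fun x => A x a b) (a b : ι) :
    ContDiff ℝ 1 fun x => (A x).adjugate a b := by
  have hform : (fun x => (A x).adjugate a b)
      = fun x => ((A x).updateRow b (Pi.single a 1)).det := by
    funext x; exact Matrix.adjugate_apply (A x) a b
  rw [hform]
  refine contDiff_det_of_entries' fun a' b' => ?_
  by_cases hab : a' = b
  · simp only [Matrix.updateRow_apply, hab, if_true]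
    exact contDiff_const
  · simp only [Matrix.updateRow_apply, hab, if_false]
    exact h a' b'

omit W in
/-- The entries of `A(x)⁻¹` are `C¹` on `{det A(x) ≠ 0}` (`A⁻¹ = det(A)⁻¹adj(A)`). [folklore] -/
private theorem contDiffOn_inv_entry' {A : X → Matrix ι ι ℝ}
    (h : ∀ a b, ContDiff ℝ 1 fun x => A x a b) (a b : ι) :
    ContDiffOn ℝ 1 (fun x => (A x)⁻¹ a b) {x | (A x).det ≠ 0} := by
  have hform : (fun x => (A x)⁻¹ a b) = fun x => ((A x).det)⁻¹ * (A x).adjugate a b := by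
    funext x
    rw [Matrix.inv_def, Ring.inverse_eq_inv, Matrix.smul_apply, smul_eq_mul]
  rw [hform]
  exact ((contDiff_det_of_entries' h).contDiffOn.inv fun x hx => hx).mul
    (contDiff_adjugate_of_entries' h a b).contDiffOn

omit W in
/-- `{det A(x) ≠ 0}` is open. [folklore] -/
private theorem isOpen_det_ne_zero' {A : X → Matrix ι ι ℝ}
    (h : ∀ a b, ContDiff ℝ 1 fun x => A x a b) : IsOpen {x | (A x).det ≠ 0} :=
  isOpen_ne_fun (contDiff_det_of_entries' h).continuous continuous_const

end MatrixEntries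

omit W in
/-- `ẏ = −A(t)y` within `[0, T]`, `A` continuous entrywise on `[0, T]`, `y(0) = 0` ⇒ `y ≡ 0` on
`[0, T]` (Grönwall). [folklore] -/
private theorem eq_zero_of_linear_of_eq_zero' {ι : Type*} [Fintype ι] {y : ℝ → ι → ℝ}
    {A : ℝ → Matrix ι ι ℝ} {T : ℝ}
    (hy : ∀ t ∈ Icc 0 T, HasDerivWithinAt y (-(A t *ᵥ y t)) (Icc 0 T) t)
    (hA : ∀ a b, ContinuousOn (fun t => A t a b) (Icc 0 T)) (h0 : y 0 = 0) :
    ∀ t ∈ Icc 0 T, y t = 0 := by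
  classical
  have hycont : ContinuousOn y (Icc 0 T) := fun t ht => (hy t ht).continuousWithinAt
  have hbd : ∀ a b : ι, ∃ C, ∀ t ∈ Icc 0 T, |A t a b| ≤ C := fun a b => by
    obtain ⟨C, hC⟩ := isCompact_Icc.exists_bound_of_continuousOn (hA a b)
    exact ⟨C, fun t ht => by simpa [Real.norm_eq_abs] using hC t ht⟩
  choose C hC using hbd
  set Kb : ℝ := ∑ a, ∑ b, |C a b| with hKb
  have hbound : ∀ t ∈ Ico 0 T, ‖-(A t *ᵥ y t)‖ ≤ Kb * ‖y t‖ := by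
    intro t ht
    have ht' : t ∈ Icc 0 T := ⟨ht.1, ht.2.le⟩
    rw [norm_neg]
    refine (pi_norm_le_iff_of_nonneg (by positivity)).2 fun a => ?_
    rw [Real.norm_eq_abs]
    calc |(A t *ᵥ y t) a| = |∑ b, A t a b * y t b| := rfl
      _ ≤ ∑ b, |A t a b * y t b| := Finset.abs_sum_le_sum_abs _ _
      _ ≤ ∑ b, |C a b| * ‖y t‖ := Finset.sum_le_sum fun b _ => by
          rw [abs_mul]
          refine mul_le_mul ((hC a b t ht').trans (le_abs_self _)) ?_ (abs_nonneg _) (abs_nonneg _)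
          simpa [Real.norm_eq_abs] using norm_le_pi_norm (y t) b
      _ = (∑ b, |C a b|) * ‖y t‖ := by rw [Finset.sum_mul]
      _ ≤ Kb * ‖y t‖ := by
          refine mul_le_mul_of_nonneg_right ?_ (norm_nonneg _)
          rw [hKb]
          exact Finset.single_le_sum (f := fun a => ∑ b, |C a b|)
            (fun a _ => Finset.sum_nonneg fun b _ => abs_nonneg _) (Finset.mem_univ a)
  have hy' : ∀ t ∈ Ico 0 T, HasDerivWithinAt y (-(A t *ᵥ y t)) (Ici t) t := by
    intro t ht
    refine (hy t ⟨ht.1, ht.2.le⟩).mono_of_mem_nhdsWithin ?_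
    exact mem_of_superset (Icc_mem_nhdsGE ht.2) (Icc_subset_Icc ht.1 le_rfl)
  exact eq_zero_of_abs_deriv_le_mul_abs_self_of_eq_zero_right hycont hy' h0 hbound

/-! ### The closed loop and the damped underlying field are `C¹` -/

/-- The rows `(BE)_k` are `C¹` in `E`. [folklore] -/
private theorem contDiff_Brow (k : Fin n ⊕ Fin m) :
    ContDiff ℝ 1 fun E : Fin n ⊕ Fin m → ℝ => (W.B *ᵥ E) k := by
  simp only [Matrix.mulVec, dotProduct]
  exact ContDiff.sum fun j _ => contDiff_const.mul (contDiff_apply ℝ ℝ j)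

/-- **The closed loop (3.3) is `C¹`** for `C¹` load models. [cite: SimpsonporcoDorflerBullo2017, §3.1 eq. (3.3)] -/
theorem contDiff_closedLoop_apply {QL : Fin n → ℝ → ℝ} (hQL : ∀ l, ContDiff ℝ 1 (QL l))
    (k : Fin n ⊕ Fin m) : ContDiff ℝ 1 fun E => W.closedLoop QL E k := by
  cases k with
  | inl l =>
    simp only [closedLoop, Sum.elim_inl]
    exact ((hQL l).comp (contDiff_apply ℝ ℝ (Sum.inl l))).add
      ((contDiff_apply ℝ ℝ _).mul (W.contDiff_Brow _))
  | inr i =>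
    simp only [closedLoop, Sum.elim_inr]
    exact (((contDiff_apply ℝ ℝ _).mul contDiff_const).mul
      ((contDiff_apply ℝ ℝ _).sub contDiff_const)).add
      ((contDiff_apply ℝ ℝ _).mul (W.contDiff_Brow _))

/-- Entries of `E ↦ J_LL(E)` (with `dQ_l = dQf_l(E_l)`) are `C¹` for `C¹` derivative models.
[cite: SimpsonporcoDorflerBullo2017, proof of Theorem 3.2, eq. (3.11′)] -/
theorem contDiff_jacLL_entry {dQf : Fin n → ℝ → ℝ} (hdQf : ∀ l, ContDiff ℝ 1 (dQf l))
    (l l' : Fin n) : ContDiff ℝ 1 fun E : Fin n ⊕ Fin m → ℝ => W.jacLL (dQState dQf E) E l l' := by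
  simp only [jacLL_apply, dQState]
  refine ((contDiff_apply ℝ ℝ _).mul contDiff_const).add ?_
  by_cases h : l = l'
  · subst h
    simp only [if_true]
    exact (W.contDiff_Brow _).add ((hdQf l).comp (contDiff_apply ℝ ℝ _))
  · simp only [h, if_false]
    exact contDiff_const

/-- Entries of `E ↦ J_LI(E)` are `C¹` (linear in `E`). [cite: SimpsonporcoDorflerBullo2017, proof of Theorem 3.2, eq. (3.11′)] -/
theorem contDiff_jacLI_entry (dQf : Fin n → ℝ → ℝ) (l : Fin n) (i : Fin m) :
    ContDiff ℝ 1 fun E : Fin n ⊕ Fin m → ℝ => W.jacLI (dQState dQf E) E l i := by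
  simp only [jacLI_apply]
  exact (contDiff_apply ℝ ℝ _).mul contDiff_const

/-- The regular set `{det J_LL(E) ≠ 0}` (index one) is open. [cite: Riaza2008, §3.1 (index one: `g_z` invertible)] -/
theorem isOpen_jacLL_regular {dQf : Fin n → ℝ → ℝ} (hdQf : ∀ l, ContDiff ℝ 1 (dQf l)) :
    IsOpen {E : Fin n ⊕ Fin m → ℝ | (W.jacLL (dQState dQf E) E).det ≠ 0} :=
  isOpen_det_ne_zero' (W.contDiff_jacLL_entry hdQf)

/-- **The damped underlying field is `C¹` on the regular set** (`C¹` loads with `C¹` derivative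
models). [cite: Riaza2008, §3.1 («the vector field (3.3) is C^{k−1}»)] -/
theorem contDiffOn_dampedField {QL dQf : Fin n → ℝ → ℝ} (hQL : ∀ l, ContDiff ℝ 1 (QL l))
    (hdQf : ∀ l, ContDiff ℝ 1 (dQf l)) (C : Matrix (Fin n) (Fin n) ℝ) :
    ContDiffOn ℝ 1 (W.dampedField QL dQf C)
      {E : Fin n ⊕ Fin m → ℝ | (W.jacLL (dQState dQf E) E).det ≠ 0} := by
  have hvel : ∀ i, ContDiff ℝ 1 fun E => W.invVel QL E i := fun i => by
    simp only [invVel]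
    exact (W.contDiff_closedLoop_apply hQL _).div_const _
  have hres : ∀ l, ContDiff ℝ 1 fun E => W.loadRes QL E l := fun l => by
    simp only [loadRes]
    exact W.contDiff_closedLoop_apply hQL _
  refine contDiffOn_pi.2 ?_
  rintro (l | i)
  · have hform : (fun E => W.dampedField QL dQf C E (Sum.inl l)) = fun E =>
        -(∑ l', (W.jacLL (dQState dQf E) E)⁻¹ l l'
            * ∑ i, W.jacLI (dQState dQf E) E l' i * W.invVel QL E i)
          - ∑ l', C l l' * W.loadRes QL E l' := by
      funext E
      simp only [dampedField, Sum.elim_inl, Pi.sub_apply, Pi.neg_apply, Matrix.mulVec, dotProduct]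
    rw [hform]
    refine ContDiffOn.sub (ContDiffOn.neg (ContDiffOn.sum fun l' _ => ?_))
      (ContDiff.contDiffOn (ContDiff.sum fun l' _ => contDiff_const.mul (hres l')))
    exact (contDiffOn_inv_entry' (W.contDiff_jacLL_entry hdQf) l l').mul
      (ContDiff.contDiffOn (ContDiff.sum fun i _ => (W.contDiff_jacLI_entry dQf l' i).mul (hvel i)))
  · have hform : (fun E => W.dampedField QL dQf C E (Sum.inr i)) = fun E => W.invVel QL E i := by
      funext E; rfl
    rw [hform]
    exact (hvel i).contDiffOn

/-- Along the damped field the load residuals obey a LINEAR equation at regular states: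
`(J(E)·dampedField(E))_L = −J_LL(E)C f_L(E)` (`J_LLJ_LL⁻¹ = 1` kills the inverter velocities).
[cite: Riaza2008, §3.1 («g(y,z) = 0 is an invariant»)] -/
theorem jac_mulVec_dampedField_inl {QL dQf : Fin n → ℝ → ℝ} (C : Matrix (Fin n) (Fin n) ℝ)
    (E : Fin n ⊕ Fin m → ℝ) (hdet : IsUnit (W.jacLL (dQState dQf E) E).det) (l : Fin n) :
    (W.jac (dQState dQf E) E *ᵥ W.dampedField QL dQf C E) (Sum.inl l)
      = -((W.jacLL (dQState dQf E) E * C) *ᵥ W.loadRes QL E) l := by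
  rw [dampedField, jac_mulVec_sumElim, Sum.elim_inl]
  simp only [Matrix.mulVec_sub, Matrix.mulVec_neg, Matrix.mulVec_mulVec,
    Matrix.mul_nonsing_inv_cancel_left _ _ hdet, Pi.add_apply, Pi.sub_apply, Pi.neg_apply]
  ring

/-- **Every solution of the damped underlying ODE near the equilibrium obeys the exponential
estimate** (Lyapunov's indirect method on `dampedField`: §6's linearisation is Hurwitz).
[cite: Khalil2002, Theorem 4.7; Riaza2008, §3.1; SimpsonporcoDorflerBullo2017, §3.2 Theorem 3.2] -/
theorem dampedField_expStable (hB : W.B.IsSymm) (hII : (-W.BIIK).PosDef) (hτ : ∀ i, 0 < W.τ i)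
    {QL dQf : Fin n → ℝ → ℝ} {EL : Fin n → ℝ} (hEL : ∀ l, 0 < EL l)
    (hEI : ∀ i, 0 < W.invVoltage EL i) (hR : W.ReducedPowerFlow QL EL)
    (hQ : ∀ l, HasDerivAt (QL l) (dQf l (EL l)) (EL l)) (hcont : ∀ l, ContinuousAt (dQf l) (EL l))
    (hH : IsHurwitz (W.jacRed (fun l => dQf l (EL l)) EL)) :
    ∃ ρ > 0, ∃ k > 0, ∃ lam > 0, ∀ (X : ℝ → Fin n ⊕ Fin m → ℝ) (T : ℝ),
      (∀ t ∈ Icc 0 T, HasDerivWithinAt X (W.dampedField QL dQf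
        (W.jacLL (fun l => dQf l (EL l)) (W.liftState EL))⁻¹ (X t)) (Icc 0 T) t) →
      ‖X 0 - W.liftState EL‖ < ρ →
      ∀ t ∈ Icc 0 T, ‖X t - W.liftState EL‖ ≤ k * ‖X 0 - W.liftState EL‖ * Real.exp (-lam * t) := by
  set E₀ : Fin n ⊕ Fin m → ℝ := W.liftState EL with hE₀
  set dQ₀ : Fin n → ℝ := fun l => dQf l (EL l) with hdQ₀
  have hdQ₀' : dQState dQf E₀ = dQ₀ := by
    funext l; rfl
  have hU : IsUnit W.BIIK.det := isUnit_BIIK_det_of_posDef hII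
  have heq : W.IsEquilibrium QL E₀ := isEquilibrium_of_reducedPowerFlow hU hR
  have hdetU : IsUnit (W.jacLL dQ₀ E₀).det := isUnit_jacLL_det hB hII hEL hEI hH
  have hdet0 : (W.jacLL (dQState dQf E₀) E₀).det ≠ 0 := by
    rw [hdQ₀']; exact hdetU.ne_zero
  set C : Matrix (Fin n) (Fin n) ℝ := (W.jacLL dQ₀ E₀)⁻¹ with hC
  have hQ₀ : ∀ l, HasDerivAt (QL l) (dQf l (E₀ (Sum.inl l))) (E₀ (Sum.inl l)) := fun l => hQ l
  have hcont₀ : ∀ l, ContinuousAt (dQf l) (E₀ (Sum.inl l)) := fun l => hcont l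
  have hV : HasFDerivAt (W.dampedField QL dQf C)
      (LinearMap.toContinuousLinearMap (Matrix.toLin' (W.dampedJac dQ₀ C E₀))) E₀ := by
    have := hasFDerivAt_dampedField (C := C) heq hQ₀ hcont₀ hdet0
    rwa [hdQ₀'] at this
  have hV0 : W.dampedField QL dQf C E₀ = 0 := dampedField_eq_zero heq
  have hHur : IsHurwitz (W.dampedJac dQ₀ C E₀) :=
    isHurwitz_dampedJac hdetU (redStateMatrix_isHurwitz hB hII hτ hEL hEI hH)
  have hHur' : ∀ (μ : ℂ) (v : Fin n ⊕ Fin m → ℂ), v ≠ 0 →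
      ((W.dampedJac dQ₀ C E₀).map ((↑) : ℝ → ℂ)) *ᵥ v = μ • v → μ.re < 0 :=
    fun μ v hv h => hHur μ v hv h
  exact Literature.Analysis.ODE.exists_expStable_of_matrix_eig_re_neg hV hV0 hHur'

/-- **Theorem 3.2's conclusion as a statement about trajectories from consistent initial data
(EXISTENCE + estimate).**  Under the hypotheses of `theorem_3_2_locallyExpStable`, with load models
`Q_l ∈ C¹` whose derivative functions `dQf_l` are `C¹` (`Q_l' = dQf_l` everywhere), there are
`ρ, k, λ > 0` such that from EVERY consistent initial condition `x` (the load rows of (3.3) hold at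
`x`) with `‖x − E*‖ < ρ` there is a C¹ solution `E` of the differential-algebraic system (3.3) on
`[0, ∞)` (`IsDAESolutionOn` on every `[0, T]`) with `E(0) = x`, and
`‖E(t) − E*‖ ≤ k‖x − E*‖e^{−λt}` for all `t ≥ 0`.  Proof: the damped underlying field is `C¹` on the
open regular set (`contDiffOn_dampedField`); every ODE solution from `x` is confined by
`dampedField_expStable` to a compact ball inside the regular set, so a global solution exists (the
tree's `exists_global_solution_of_confined`); along it the load residuals solve the linear equation
`ẏ = −J_LL(E(t))J_LL(E*)⁻¹y` with `y(0) = 0` (`jac_mulVec_dampedField_inl`), hence vanish (Grönwall),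
i.e. `E` solves the DAE; the inverter rows are the field's by construction.
[cite: SimpsonporcoDorflerBullo2017, §3.2 Theorem 3.2 («locally exponentially stable»); Riaza2008, §3.1 (reduction to the underlying ODE; invariance of the constraint set; consistent initial conditions); RoucheHabetsLaloy1977, Ch. I Thm 6.2 (a); Khalil2002, Theorem 4.7] -/
theorem exists_daeSolution_expStable (hB : W.B.IsSymm) (hII : (-W.BIIK).PosDef)
    (hτ : ∀ i, 0 < W.τ i) {QL dQf : Fin n → ℝ → ℝ} {EL : Fin n → ℝ} (hEL : ∀ l, 0 < EL l)
    (hEI : ∀ i, 0 < W.invVoltage EL i) (hR : W.ReducedPowerFlow QL EL)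
    (hQL : ∀ l, ContDiff ℝ 1 (QL l)) (hdQf : ∀ l, ContDiff ℝ 1 (dQf l))
    (hQ : ∀ l e, HasDerivAt (QL l) (dQf l e) e)
    (hH : IsHurwitz (W.jacRed (fun l => dQf l (EL l)) EL)) :
    ∃ ρ > 0, ∃ k > 0, ∃ lam > 0, ∀ x : Fin n ⊕ Fin m → ℝ, ‖x - W.liftState EL‖ < ρ →
      (∀ l, W.closedLoop QL x (Sum.inl l) = 0) →
      ∃ E : ℝ → Fin n ⊕ Fin m → ℝ, E 0 = x ∧ (∀ T : ℝ, W.IsDAESolutionOn QL E T) ∧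
        ∀ t : ℝ, 0 ≤ t → ‖E t - W.liftState EL‖ ≤ k * ‖x - W.liftState EL‖ * Real.exp (-lam * t) := by
  set E₀ : Fin n ⊕ Fin m → ℝ := W.liftState EL with hE₀
  set dQ₀ : Fin n → ℝ := fun l => dQf l (EL l) with hdQ₀
  set C : Matrix (Fin n) (Fin n) ℝ := (W.jacLL dQ₀ E₀)⁻¹ with hC
  obtain ⟨ρ, hρ, k, hk, lam, hlam, H⟩ := dampedField_expStable hB hII hτ hEL hEI hR
    (fun l => hQ l _) (fun l => (hdQf l).continuous.continuousAt) hH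
  -- the open regular set contains a ball around `E₀`
  set O : Set (Fin n ⊕ Fin m → ℝ) := {E | (W.jacLL (dQState dQf E) E).det ≠ 0} with hOdef
  have hO : IsOpen O := W.isOpen_jacLL_regular hdQf
  have hdQ₀' : dQState dQf E₀ = dQ₀ := by
    funext l; rfl
  have hE₀O : E₀ ∈ O := by
    show (W.jacLL (dQState dQf E₀) E₀).det ≠ 0
    rw [hdQ₀']
    exact (isUnit_jacLL_det hB hII hEL hEI hH).ne_zero
  obtain ⟨r, hr, hball⟩ := Metric.isOpen_iff.1 hO E₀ hE₀O
  set ρ' : ℝ := min (ρ / 2) (r / (2 * (k + 1))) with hρ'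
  have hρ'pos : 0 < ρ' := lt_min (by positivity) (by positivity)
  have hρ'ρ : ρ' < ρ := lt_of_le_of_lt (min_le_left _ _) (by linarith)
  have hρ'r : k * ρ' < r := by
    have h1 : ρ' ≤ r / (2 * (k + 1)) := min_le_right _ _
    have h2 : k * ρ' ≤ k * (r / (2 * (k + 1))) := mul_le_mul_of_nonneg_left h1 hk.le
    have h3 : k * (r / (2 * (k + 1))) < r := by
      rw [mul_div_assoc', div_lt_iff₀ (by positivity)]
      nlinarith
    linarith
  refine ⟨ρ', hρ'pos, k, hk, lam, hlam, fun x hx hcons => ?_⟩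
  have hxρ : ‖x - E₀‖ < ρ := hx.trans hρ'ρ
  -- confinement of every ODE solution from `x` to a compact ball inside the regular set
  set K : Set (Fin n ⊕ Fin m → ℝ) := closedBall E₀ (k * ‖x - E₀‖) with hKdef
  have hKcpt : IsCompact K := isCompact_closedBall _ _
  have hKO : K ⊆ O := by
    intro y hy
    rw [hKdef, mem_closedBall] at hy
    refine hball (mem_ball.2 (lt_of_le_of_lt hy ?_))
    calc k * ‖x - E₀‖ ≤ k * ρ' := mul_le_mul_of_nonneg_left hx.le hk.le
      _ < r := hρ'r
  have hconf : ∀ s : ℝ, ∀ X : ℝ → Fin n ⊕ Fin m → ℝ, X 0 = x →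
      (∀ t ∈ Icc 0 s, HasDerivWithinAt X (W.dampedField QL dQf C (X t)) (Icc 0 s) t) →
      ∀ t ∈ Icc 0 s, X t ∈ K := by
    intro s X hX0 hX t ht
    have hest := H X s hX (by rw [hX0]; exact hxρ) t ht
    rw [hX0] at hest
    rw [hKdef, mem_closedBall, dist_eq_norm]
    have hexp : Real.exp (-lam * t) ≤ 1 := Real.exp_le_one_iff.2 (by nlinarith [ht.1])
    exact hest.trans (mul_le_of_le_one_right (by positivity) hexp)
  obtain ⟨X, hX0, hX⟩ := Literature.Analysis.ODE.exists_global_solution_of_confined hO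
    (W.contDiffOn_dampedField hQL hdQf C) hKcpt hKO hconf
  have hreg : ∀ T : ℝ, ∀ t ∈ Icc (0 : ℝ) T, IsUnit (W.jacLL (dQState dQf (X t)) (X t)).det :=
    fun T t ht => isUnit_iff_ne_zero.2 (hKO (hconf T X hX0 (hX T) t ht))
  -- invariance of the load constraints along `X`
  have hload : ∀ T : ℝ, ∀ t ∈ Icc (0 : ℝ) T, ∀ l, W.closedLoop QL (X t) (Sum.inl l) = 0 := by
    intro T
    set A : ℝ → Matrix (Fin n) (Fin n) ℝ := fun t => W.jacLL (dQState dQf (X t)) (X t) * C with hA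
    have hy : ∀ t ∈ Icc (0 : ℝ) T, HasDerivWithinAt (fun s => W.loadRes QL (X s))
        (-(A t *ᵥ W.loadRes QL (X t))) (Icc 0 T) t := by
      intro t ht
      have hcl : HasFDerivAt (W.closedLoop QL)
          (LinearMap.toContinuousLinearMap (Matrix.toLin' (W.jac (dQState dQf (X t)) (X t))))
          (X t) := hasFDerivAt_closedLoop fun l => hQ l _
      have hcomp := hcl.comp_hasDerivWithinAt t (hX T t ht)
      refine hasDerivWithinAt_pi.2 fun l => ?_
      have hl := (ContinuousLinearMap.proj (R := ℝ) (φ := fun _ : Fin n ⊕ Fin m => ℝ)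
        (Sum.inl l)).hasFDerivAt.comp_hasDerivWithinAt t hcomp
      refine hl.congr_deriv ?_
      rw [ContinuousLinearMap.proj_apply, LinearMap.coe_toContinuousLinearMap',
        Matrix.toLin'_apply, W.jac_mulVec_dampedField_inl C (X t) (hreg T t ht) l, Pi.neg_apply]
    have hAcont : ∀ a b, ContinuousOn (fun t => A t a b) (Icc 0 T) := by
      intro a b
      have hXc : ContinuousOn X (Icc 0 T) := fun t ht => (hX T t ht).continuousWithinAt
      simp only [hA, Matrix.mul_apply]
      refine continuousOn_finsetSum _ fun c _ => ?_
      exact ((W.contDiff_jacLL_entry hdQf a c).continuous.comp_continuousOn hXc).mul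
        continuousOn_const
    have h0 : W.loadRes QL (X 0) = 0 := by
      funext l
      rw [hX0]
      exact hcons l
    intro t ht l
    have := eq_zero_of_linear_of_eq_zero' hy hAcont h0 t ht
    exact congrFun this l
  refine ⟨X, hX0, fun T => ⟨fun t => W.dampedField QL dQf C (X t), fun t ht =>
    ⟨hX T t ht, hload T t ht, fun i => rfl⟩⟩, fun t ht => ?_⟩
  have hest := H X t (hX t) (by rw [hX0]; exact hxρ) t ⟨ht, le_rfl⟩
  rw [hX0] at hest
  exact hest

/-- **Theorem 3.3 from network data, with existence of the DAE solutions**: connected inductive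
network, `K_i < 0`, `E_i* > 0`, `τ_i > 0`, at least one inverter, ZI loads with
`−(B_red + [b_sh]) ≻ 0` and `I_sh > B_redE_L*`: from every consistent initial condition close to
`(E_L^{ZI}, E_I^{ZI})` the closed loop (3.3) has a C¹ solution on `[0, ∞)`, and it converges to the
equilibrium exponentially.
[cite: SimpsonporcoDorflerBullo2017, §3.3 Theorem 3.3 with §3.2 Theorem 3.2 and §7 Lemma 7.1 / Proposition 7.2; Riaza2008, §3.1] -/
theorem exists_daeSolution_expStable_of_network {w : Fin n ⊕ Fin m → Fin n ⊕ Fin m → ℝ}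
    {bsh Ish : Fin n → ℝ} (hw : ∀ i j, w i j = w j i) (hw0 : ∀ i j, 0 ≤ w i j)
    (hconn : BranchConnected w) (hBw : W.B = susceptanceMatrix w) (hK : ∀ i, W.K i < 0)
    (hm : 0 < m) (hE : ∀ i, 0 < W.Estar i) (hτ : ∀ i, 0 < W.τ i)
    (hA : (-(W.Bred + diagonal bsh)).PosDef) (hI : ∀ l, W.redSource l < Ish l) :
    ∃ ρ > 0, ∃ k > 0, ∃ lam > 0, ∀ x : Fin n ⊕ Fin m → ℝ, ‖x - W.ziState bsh Ish‖ < ρ →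
      (∀ l, W.closedLoop (ziLoad bsh Ish) x (Sum.inl l) = 0) →
      ∃ E : ℝ → Fin n ⊕ Fin m → ℝ, E 0 = x ∧ (∀ T : ℝ, W.IsDAESolutionOn (ziLoad bsh Ish) E T) ∧
        ∀ t : ℝ, 0 ≤ t →
          ‖E t - W.ziState bsh Ish‖ ≤ k * ‖x - W.ziState bsh Ish‖ * Real.exp (-lam * t) := by
  have hB : W.B.IsSymm := by rw [hBw]; exact susceptanceMatrix_isSymm hw
  have hoff : ∀ k k', k ≠ k' → 0 ≤ W.B k k' := fun k k' hkk' => by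
    rw [hBw]; exact susceptanceMatrix_offDiag_nonneg hw0 hkk'
  have hM := posDef_neg_aug_of_branchConnected hw hw0 hconn hBw hK hm
  have hII := posDef_neg_BIIK_of_posDef_aug hM
  obtain ⟨-, hpos, -, hHur⟩ := theorem_3_3_of_network hw hw0 hconn hBw hK hm hE hA hI
  obtain ⟨-, -, hZ⟩ := stieltjes_neg_Bred hB hoff hM bsh
  obtain ⟨-, hR, -, -⟩ := theorem_3_3_ziLoads hA hZ hI
  have hEL : ∀ l, 0 < W.ziVoltage bsh Ish l := fun l => hpos (Sum.inl l)
  have hEI : ∀ i, 0 < W.invVoltage (W.ziVoltage bsh Ish) i := fun i => hpos (Sum.inr i)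
  set dQf : Fin n → ℝ → ℝ := fun l e => 2 * bsh l * e + Ish l with hdQf
  have hQL : ∀ l, ContDiff ℝ 1 (ziLoad bsh Ish l) := fun l => by
    have : ziLoad bsh Ish l = fun e => bsh l * e ^ 2 + Ish l * e := rfl
    rw [this]
    exact (contDiff_const.mul (contDiff_id.pow 2)).add (contDiff_const.mul contDiff_id)
  have hdQ : ∀ l, ContDiff ℝ 1 (dQf l) := fun l =>
    (contDiff_const.mul contDiff_id).add contDiff_const
  have hQ : ∀ l e, HasDerivAt (ziLoad bsh Ish l) (dQf l e) e := fun l e => by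
    have h1 := ((hasDerivAt_id e).pow 2).const_mul (bsh l)
    have h2 := (hasDerivAt_id e).const_mul (Ish l)
    refine ((h1.add h2).congr_of_eventuallyEq
      (Filter.Eventually.of_forall fun e' => ?_)).congr_deriv ?_
    · simp [ziLoad]
    · simp [hdQf]
      ring
  exact exists_daeSolution_expStable hB hII hτ hEL hEI hR hQL hdQ hQ hHur

/-- **Uniqueness of the DAE solutions near the equilibrium** (index one: the solutions of (3.3) are
those of the underlying ODE on the constraint set, and a `C¹` field has unique solutions).  Under the
hypotheses of `exists_daeSolution_expStable` there is `ρ > 0` such that two C¹ solutions of (3.3) on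
`[0, T]` with the same initial condition `ρ`-close to `E*` coincide on `[0, T]`.  Proof: both are
confined by §6's estimate to a compact ball inside the regular set `{det J_LL ≠ 0}`, on which the
damped underlying field is `C¹`, hence Lipschitz (tree `exists_lipschitzOnWith_of_isCompact`); both
solve `Ė = dampedField(E)` there (`hasDerivWithinAt_dampedField`); Grönwall (tree
`dist_le_of_solutions`).
[cite: Riaza2008, §3.1 («the solutions of the DAE are those of the vector field (3.3) … on the manifold g = 0»); SimpsonporcoDorflerBullo2017, §3.2 Theorem 3.2; RoucheHabetsLaloy1977, Ch. I Thm 6.2 (a)] -/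
theorem daeSolution_unique (hB : W.B.IsSymm) (hII : (-W.BIIK).PosDef)
    (hτ : ∀ i, 0 < W.τ i) {QL dQf : Fin n → ℝ → ℝ} {EL : Fin n → ℝ} (hEL : ∀ l, 0 < EL l)
    (hEI : ∀ i, 0 < W.invVoltage EL i) (hR : W.ReducedPowerFlow QL EL)
    (hQL : ∀ l, ContDiff ℝ 1 (QL l)) (hdQf : ∀ l, ContDiff ℝ 1 (dQf l))
    (hQ : ∀ l e, HasDerivAt (QL l) (dQf l e) e)
    (hH : IsHurwitz (W.jacRed (fun l => dQf l (EL l)) EL)) :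
    ∃ ρ > 0, ∀ (E₁ E₂ : ℝ → Fin n ⊕ Fin m → ℝ) (T : ℝ),
      W.IsDAESolutionOn QL E₁ T → W.IsDAESolutionOn QL E₂ T → E₁ 0 = E₂ 0 →
      ‖E₁ 0 - W.liftState EL‖ < ρ → ∀ t ∈ Icc (0 : ℝ) T, E₁ t = E₂ t := by
  set E₀ : Fin n ⊕ Fin m → ℝ := W.liftState EL with hE₀
  set dQ₀ : Fin n → ℝ := fun l => dQf l (EL l) with hdQ₀
  set C : Matrix (Fin n) (Fin n) ℝ := (W.jacLL dQ₀ E₀)⁻¹ with hC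
  obtain ⟨ρ, hρ, k, hk, lam, hlam, H⟩ := theorem_3_2_locallyExpStable hB hII hτ hEL hEI hR
    (fun l => Filter.Eventually.of_forall fun e => hQ l e)
    (fun l => (hdQf l).continuous.continuousAt) hH
  set O : Set (Fin n ⊕ Fin m → ℝ) := {E | (W.jacLL (dQState dQf E) E).det ≠ 0} with hOdef
  have hO : IsOpen O := W.isOpen_jacLL_regular hdQf
  have hdQ₀' : dQState dQf E₀ = dQ₀ := by
    funext l; rfl
  have hE₀O : E₀ ∈ O := by
    show (W.jacLL (dQState dQf E₀) E₀).det ≠ 0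
    rw [hdQ₀']
    exact (isUnit_jacLL_det hB hII hEL hEI hH).ne_zero
  obtain ⟨r, hr, hball⟩ := Metric.isOpen_iff.1 hO E₀ hE₀O
  set ρ' : ℝ := min (ρ / 2) (r / (2 * (k + 1))) with hρ'
  have hρ'pos : 0 < ρ' := lt_min (by positivity) (by positivity)
  have hρ'ρ : ρ' < ρ := lt_of_le_of_lt (min_le_left _ _) (by linarith)
  have hρ'r : k * ρ' < r := by
    have h1 : ρ' ≤ r / (2 * (k + 1)) := min_le_right _ _
    have h2 : k * ρ' ≤ k * (r / (2 * (k + 1))) := mul_le_mul_of_nonneg_left h1 hk.le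
    have h3 : k * (r / (2 * (k + 1))) < r := by
      rw [mul_div_assoc', div_lt_iff₀ (by positivity)]
      nlinarith
    linarith
  -- the compact ball where both solutions live, and a Lipschitz constant of the field on it
  set K : Set (Fin n ⊕ Fin m → ℝ) := closedBall E₀ (k * ρ') with hKdef
  have hKcpt : IsCompact K := isCompact_closedBall _ _
  have hKO : K ⊆ O := fun y hy => hball (mem_ball.2 (lt_of_le_of_lt (mem_closedBall.1 hy) hρ'r))
  obtain ⟨Lip, hLip⟩ := Literature.Analysis.ODE.exists_lipschitzOnWith_of_isCompact hO
    (W.contDiffOn_dampedField hQL hdQf C) hKcpt hKO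
  refine ⟨ρ', hρ'pos, fun E₁ E₂ T h₁ h₂ h0 hx t ht => ?_⟩
  rcases le_or_gt T 0 with hT | hT
  · have : t = 0 := le_antisymm (ht.2.trans hT) ht.1
    rw [this, h0]
  -- both solutions stay in `K` and solve the underlying ODE
  have hinK : ∀ {E : ℝ → Fin n ⊕ Fin m → ℝ}, W.IsDAESolutionOn QL E T → ‖E 0 - E₀‖ < ρ' →
      ∀ s ∈ Icc (0 : ℝ) T, E s ∈ K := by
    intro E hE hE0 s hs
    have hest := H E T hE (hE0.trans hρ'ρ) s hs
    rw [hKdef, mem_closedBall, dist_eq_norm]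
    have hexp : Real.exp (-lam * s) ≤ 1 := Real.exp_le_one_iff.2 (by nlinarith [hs.1])
    calc ‖E s - E₀‖ ≤ k * ‖E 0 - E₀‖ * Real.exp (-lam * s) := hest
      _ ≤ k * ‖E 0 - E₀‖ := mul_le_of_le_one_right (by positivity) hexp
      _ ≤ k * ρ' := mul_le_mul_of_nonneg_left hE0.le hk.le
  have hode : ∀ {E : ℝ → Fin n ⊕ Fin m → ℝ}, W.IsDAESolutionOn QL E T → ‖E 0 - E₀‖ < ρ' →
      ∀ s ∈ Icc (0 : ℝ) T, HasDerivWithinAt E (W.dampedField QL dQf C (E s)) (Icc 0 T) s := by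
    intro E hE hE0 s hs
    obtain ⟨E', hE'⟩ := hE
    exact hasDerivWithinAt_dampedField C hT hs (hE' s hs).1 (fun s' hs' => (hE' s' hs').2.1)
      (hE' s hs).2.2 (fun l => hQ l _) (isUnit_iff_ne_zero.2 (hKO (hinK ⟨E', hE'⟩ hE0 s hs)))
  have hx₂ : ‖E₂ 0 - E₀‖ < ρ' := by rw [← h0]; exact hx
  have hd := Literature.Analysis.ODE.dist_le_of_solutions hLip (hode h₁ hx) (hode h₂ hx₂)
    (hinK h₁ hx) (hinK h₂ hx₂) t ht
  rw [h0, dist_self, zero_mul] at hd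
  exact dist_le_zero.1 hd

end DAEExistence

end QuadDroopNetwork

end Literature.MathematicalPhysics.PowerSystems

end
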